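import Literature.NumberTheory.DiophantineApproximation.GeneralizedPolynomials
import Literature.NumberTheory.DiophantineApproximation.FloorMultipleSequenceUD
import Literature.NumberTheory.DiophantineApproximation.GeneralizedPolynomialsUD
import Literature.NumberTheory.UniformDistribution.EquidistributedModOne

/-!
# Weyl's equidistribution theorem and van der Corput's difference theorem along Følner sequences of `ℤ`; the polynomial layer of Bergelson–Leibman 2007, Cor. 0.26

Companion PROOFS file of `GeneralizedPolynomials.lean` (the named fact
`BergelsonLeibman2007_cor_0_26`: for every generalized polynomial `u : ℤ → ℝ` the averages
`|Φ_N|⁻¹ Σ_{n ∈ Φ_N} e(u(n))` converge, to a limit not depending on the Følner sequence `Φ`).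
Everything here is PROVED (no `sorry`, no new named fact). Contents:

* `IsFoelnerSeq` API for the tree's generator-`1` Følner sequences of `ℤ`
  (`IsFoelnerSeq.tendsto_shift`: asymptotic invariance under EVERY shift `k : ℤ`, from
  `|A ∆ (A + k)| ≤ |k| · |A ∆ (A + 1)|`; `IsFoelnerSeq.tendsto_card_atTop`: `|Φ_N| → ∞`).
* `IsFoelnerSeq.tendsto_avg_e_linear` — degree one: `θ ∉ ℤ ⇒ |Φ_N|⁻¹ Σ_{n ∈ Φ_N} e(nθ) → 0`, from
  the finitary estimate `|e(θ) - 1| · |Σ_{n ∈ A} e(nθ)| ≤ |A ∆ (A + 1)|`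
  (`FoelnerWeyl.norm_sum_e_linear_le`).
* `IsFoelnerSeq.tendsto_avg_zero_of_corr` — **van der Corput's difference theorem along Følner
  sequences**: for `1`-bounded `a : ℤ → ℂ`, if every correlation average
  `|Φ_N|⁻¹ Σ_{n ∈ Φ_N} a(n + k) conj a(n)`, `k ≠ 0`, tends to `0`, then `|Φ_N|⁻¹ Σ a(n) → 0`; from
  the finitary inequality `FoelnerWeyl.vdC_avg_le`.
* `IsFoelnerSeq.tendsto_avg_e_poly_of_irrational` — **Weyl 1916, Satz 9, Følner form**: if the
  top coefficient considered is irrational the averages of `e(p(n))` vanish along every Følner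
  sequence (induction on the degree by differencing `p(X + k) - p(X)`,
  `FoelnerWeyl.coeff_taylor_sub`).
* `exists_tendsto_avg_e_poly` / `weyl_foelner_limit` — for EVERY real polynomial `p` there is
  ONE `c ∈ ℂ` with `|Φ_N|⁻¹ Σ_{n ∈ Φ_N} e(p(n)) → c` for all Følner `Φ` (rational top coefficient
  `m/q`: finite Fourier expansion of the `q`-periodic factor `e((m/q) n^d)`,
  `FoelnerWeyl.periodic_expansion`, and induction).
* `weyl_foelner_limit_torus` — joint version (Bergelson–Leibman §0.7 after Weyl 1916, Thm 18):
  for a polynomial mapping `P : ι → ℝ[X]` and every CONTINUOUS `G : 𝕋^ι → ℂ`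
  (`UnitAddTorus ι`), the averages `|Φ_N|⁻¹ Σ_{n ∈ Φ_N} G(P(n) mod 1)` converge to a
  Følner-independent limit (characters ↦ `weyl_foelner_limit`; closed subspace; density of
  trigonometric polynomials `UnitAddTorus.span_mFourier_closure_eq_top`); `isFoelnerSeq_Ico`: the
  initial segments are a Følner sequence.
* `foelner_limit_of_sandwich` / `foelner_limit_of_re_im` — the measure-free Riemann-integrability
  step of Bergelson–Leibman's Thm 4.2 (a real sequence squeezed, for every `ε`, between sequences
  with Følner-independent limits `< ε` apart has one too); `IsFoelnerSeq.tendsto_avg_of_periodic` —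
  `q`-periodic sequences have the Følner-independent limit `q⁻¹ Σ_{r<q} F(r)`.
* `IsFoelnerSeq.tendsto_avg_e_poly_zero` — Weyl's Satz 9 in full (SOME coefficient of positive
  degree irrational ⇒ the averages vanish); `integral_mFourier_eq`;
  `weyl_tendsto_avg_integral_torus` — **Weyl's Satz 14 along Følner sequences**: if every
  `Σ mᵢPᵢ`, `m ≠ 0`, has an irrational coefficient of positive degree, the averages of a continuous
  `G` along `(Pᵢ(n))ᵢ mod 1` converge to the Haar integral `∫_{𝕋^ι} G`;
  `weyl_tendsto_avg_integral_circle` — the one-variable case (Satz 12).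
* `weyl_tendsto_card_fract_mem_Ico` — Satz 12 in COUNTING form along Følner sequences (via the
  tree's `WeylCircle.tendsto_card_arc_div`), and for `ℕ`-indexed sequences in each of the tree's
  three renderings of "u.d. mod 1": `isUniformlyDistributedModOne_polynomial`
  (`FloorMultipleSequenceUD`), `isUDModOne_polynomial` (`GeneralizedPolynomialsUD`),
  `equidistributedModOne_polynomial_of_irrational_coeff` (`UniformDistribution.EquidistributedModOne`,
  the notion of route BenfordTowers) — `(p(n))` is u.d. mod 1 as soon as SOME coefficient of positive
  degree is irrational; `isUniformlyDistributedModOne_mul_irrational` (`nθ`, Satz 13).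
* `bergelsonLeibman2007_cor_0_26_poly` — the case `u = p(n)` (constructor
  `IsGeneralizedPolynomial.poly`) of the fact, and `BergelsonLeibman2007_cor_0_26_of_bounded` — the
  printed reduction of Cor. 0.26 to BOUNDED generalized polynomials (`e(u) = e({u})`), i.e. to
  Cor. 0.25 / Theorem B of the paper.

What is NOT here (and why the fact itself stays undischarged): already for continuous `G` replaced by
the discontinuous `x ↦ e(c{x})` (one bracket) one needs the limit DISTRIBUTION of `P(n) mod 1` (a
union of sub-tori, B–L Thm 0.7) and Riemann-integrability relative to it; in general Theorem B needs
Bergelson–Leibman's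
Theorem A** (bounded GP = piecewise-polynomial image of a polynomial orbit on a nilmanifold,
§§5–10 of the paper) and Leibman's well-distribution of polynomial orbits on nilmanifolds
(Thm 2.3 there); Mathlib has no nilmanifolds. The abelian (torus) layer is exactly Weyl's theorem,
proved here.

## References

* [Weyl1916] H. Weyl, *Über die Gleichverteilung von Zahlen mod. Eins*, Math. Ann. 77 (1916)
  313–352 — Satz 9 p. 326 (polynomial Weyl sums `o(n)`; Zusatz: uniformly in the lower
  coefficients, hence along shifted intervals), Satz 12 (held text `paper:doi-10-1007-bf01475864`).
* [BergelsonLeibman2007] V. Bergelson, A. Leibman, *Distribution of values of bounded generalized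
  polynomials*, Acta Math. 198 (2007) 155–230 — §0.11 (the van der Corput difference theorem),
  §0.21–0.22 (Følner sequences, well-distribution), Cor. 0.25–0.26.
* van der Corput's difference theorem in Følner form is standard ("van der Corput trick");
  tagged `[folklore]` below.
-/

noncomputable section

open Filter Finset Polynomial
open scoped symmDiff Topology ComplexConjugate

namespace Literature.NumberTheory.DiophantineApproximation

namespace FoelnerWeyl

/-! ### Shifts of finite sets of integers -/

/-- `(A + a) + b = A + (a + b)`. [folklore] -/
theorem image_add_image_add (A : Finset ℤ) (a b : ℤ) :
    (A.image fun n => n + a).image (fun n => n + b) = A.image fun n => n + (a + b) := by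
  rw [Finset.image_image]
  congr 1
  funext n
  simp [add_assoc]

/-- `|A + a| = |A|`. [folklore] -/
theorem card_image_add (A : Finset ℤ) (a : ℤ) : (A.image fun n => n + a).card = A.card :=
  Finset.card_image_of_injective _ (add_left_injective a)

/-- One new element appears when a non-empty finite set of integers is shifted by one:
`1 ≤ |A ∆ (A + 1)|`. [folklore] -/
theorem one_le_card_symmDiff_shift {A : Finset ℤ} (hA : A.Nonempty) :
    1 ≤ (A ∆ (A.image fun n => n + 1)).card := by
  rw [Nat.one_le_iff_ne_zero, Ne, Finset.card_eq_zero, ← Ne, ← Finset.nonempty_iff_ne_empty]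
  refine ⟨A.max' hA + 1, ?_⟩
  rw [Finset.mem_symmDiff]
  refine Or.inr ⟨Finset.mem_image.2 ⟨A.max' hA, A.max'_mem hA, rfl⟩, fun h => ?_⟩
  have := A.le_max' _ h
  linarith

/-- Sub-additivity of the shift defect: `|A ∆ (A + k)| ≤ k · |A ∆ (A + 1)|`. [folklore] -/
theorem card_symmDiff_shift_nat_le (A : Finset ℤ) (k : ℕ) :
    (A ∆ (A.image fun n => n + (k : ℤ))).card ≤ k * (A ∆ (A.image fun n => n + 1)).card := by
  induction k with
  | zero => simp
  | succ k ih =>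
    have hsub : A ∆ (A.image fun n => n + ((k + 1 : ℕ) : ℤ)) ⊆
        (A ∆ (A.image fun n => n + (k : ℤ))) ∪
          ((A.image fun n => n + (k : ℤ)) ∆ (A.image fun n => n + ((k + 1 : ℕ) : ℤ))) :=
      symmDiff_triangle _ _ _
    have himg : (A.image fun n => n + (k : ℤ)) ∆ (A.image fun n => n + ((k + 1 : ℕ) : ℤ)) =
        (A ∆ (A.image fun n => n + 1)).image fun n => n + (k : ℤ) := by
      rw [Finset.image_symmDiff _ _ (add_left_injective (k : ℤ)), image_add_image_add]
      congr 2
      funext n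
      push_cast
      ring
    calc (A ∆ (A.image fun n => n + ((k + 1 : ℕ) : ℤ))).card
        ≤ ((A ∆ (A.image fun n => n + (k : ℤ))) ∪
            ((A.image fun n => n + (k : ℤ)) ∆ (A.image fun n => n + ((k + 1 : ℕ) : ℤ)))).card :=
          Finset.card_le_card hsub
      _ ≤ (A ∆ (A.image fun n => n + (k : ℤ))).card +
            ((A.image fun n => n + (k : ℤ)) ∆ (A.image fun n => n + ((k + 1 : ℕ) : ℤ))).card :=
          Finset.card_union_le _ _
      _ ≤ k * (A ∆ (A.image fun n => n + 1)).card + (A ∆ (A.image fun n => n + 1)).card := by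
          rw [himg, card_image_add]; exact Nat.add_le_add_right ih _
      _ = (k + 1) * (A ∆ (A.image fun n => n + 1)).card := by ring

/-- The shift defect is symmetric under `k ↦ -k`. [folklore] -/
theorem card_symmDiff_shift_neg (A : Finset ℤ) (k : ℤ) :
    (A ∆ (A.image fun n => n + (-k))).card = (A ∆ (A.image fun n => n + k)).card := by
  have h : A ∆ (A.image fun n => n + (-k)) =
      ((A.image fun n => n + k) ∆ A).image fun n => n + (-k) := by
    rw [Finset.image_symmDiff _ _ (add_left_injective (-k)), image_add_image_add]
    simp
  rw [h, card_image_add, symmDiff_comm]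

/-- `|A ∆ (A + k)| ≤ |k| · |A ∆ (A + 1)|` for every `k : ℤ`. [folklore] -/
theorem card_symmDiff_shift_int_le (A : Finset ℤ) (k : ℤ) :
    (A ∆ (A.image fun n => n + k)).card ≤ k.natAbs * (A ∆ (A.image fun n => n + 1)).card := by
  obtain ⟨m, rfl | rfl⟩ := Int.eq_nat_or_neg k
  · simpa using card_symmDiff_shift_nat_le A m
  · rw [card_symmDiff_shift_neg]
    simpa using card_symmDiff_shift_nat_le A m

/-! ### Bounded sums over nearly equal sets -/

/-- Re-indexing a sum over a shifted set. [folklore] -/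
theorem sum_image_add {M : Type*} [AddCommMonoid M] (f : ℤ → M) (A : Finset ℤ) (k : ℤ) :
    ∑ n ∈ A.image (fun n => n + k), f n = ∑ n ∈ A, f (n + k) :=
  Finset.sum_image fun _ _ _ _ h => add_left_injective k h

/-- A `1`-bounded sum is bounded by the number of terms. [folklore] -/
theorem norm_sum_le_card {f : ℤ → ℂ} (hf : ∀ n, ‖f n‖ ≤ 1) (A : Finset ℤ) :
    ‖∑ n ∈ A, f n‖ ≤ A.card := by
  calc ‖∑ n ∈ A, f n‖ ≤ ∑ n ∈ A, ‖f n‖ := norm_sum_le _ _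
    _ ≤ ∑ _n ∈ A, (1 : ℝ) := Finset.sum_le_sum fun n _ => hf n
    _ = A.card := by simp

/-- Sums of a `1`-bounded function over two finite sets differ by at most the size of the
symmetric difference. [folklore] -/
theorem norm_sum_sub_sum_le {f : ℤ → ℂ} (hf : ∀ n, ‖f n‖ ≤ 1) (A B : Finset ℤ) :
    ‖∑ n ∈ A, f n - ∑ n ∈ B, f n‖ ≤ (A ∆ B).card := by
  rw [← Finset.sum_sdiff_sub_sum_sdiff]
  have hcard : ((A ∆ B).card : ℝ) = (A \ B).card + (B \ A).card := by
    rw [symmDiff_def, Finset.sup_eq_union, Finset.card_union_of_disjoint disjoint_sdiff_sdiff]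
    push_cast
    ring
  calc ‖∑ n ∈ A \ B, f n - ∑ n ∈ B \ A, f n‖
      ≤ ‖∑ n ∈ A \ B, f n‖ + ‖∑ n ∈ B \ A, f n‖ := norm_sub_le _ _
    _ ≤ (A \ B).card + (B \ A).card := add_le_add (norm_sum_le_card hf _) (norm_sum_le_card hf _)
    _ = (A ∆ B).card := hcard.symm

/-- Shifting the argument of a `1`-bounded function changes its sum over `A` by at most
`|A ∆ (A + k)|`. [folklore] -/
theorem norm_sum_shift_sub_sum_le {f : ℤ → ℂ} (hf : ∀ n, ‖f n‖ ≤ 1) (A : Finset ℤ) (k : ℤ) :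
    ‖∑ n ∈ A, f (n + k) - ∑ n ∈ A, f n‖ ≤ (A ∆ (A.image fun n => n + k)).card := by
  rw [← sum_image_add, ← norm_neg, neg_sub]
  exact norm_sum_sub_sum_le hf _ _

/-- Norm of an average: `‖|A|⁻¹ S‖ = ‖S‖ / |A|`. [folklore] -/
theorem norm_avg_eq (A : Finset ℤ) (S : ℂ) : ‖((A.card : ℂ))⁻¹ * S‖ = ‖S‖ / A.card := by
  rw [norm_mul, norm_inv, Complex.norm_natCast, div_eq_inv_mul]

/-! ### The character `e(x) = exp(2πix)` -/

/-- `|e(x)| ≤ 1` (the equality `‖e(x)‖ = 1` is `Literature.NumberTheory.Sieve.norm_exp_two_pi_mul_I`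
in `Sieve/PolynomialCongruencesWeyl.lean`; only the inequality is needed here). [folklore] -/
theorem norm_e_le (x : ℝ) : ‖Complex.exp (2 * Real.pi * Complex.I * x)‖ ≤ 1 := by
  rw [Complex.norm_exp]
  simp

/-- `e(x + y) = e(x) e(y)`. [folklore] -/
theorem e_add (x y : ℝ) : Complex.exp (2 * Real.pi * Complex.I * ((x + y : ℝ) : ℂ)) =
    Complex.exp (2 * Real.pi * Complex.I * x) * Complex.exp (2 * Real.pi * Complex.I * y) := by
  rw [← Complex.exp_add]
  push_cast
  ring_nf

/-- `e(m) = 1` for `m ∈ ℤ`. [folklore] -/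
theorem e_int (m : ℤ) : Complex.exp (2 * Real.pi * Complex.I * ((m : ℝ) : ℂ)) = 1 := by
  rw [Complex.exp_eq_one_iff]
  exact ⟨m, by push_cast; ring⟩

/-- `e(x + m) = e(x)` for `m ∈ ℤ`. [folklore] -/
theorem e_add_int (x : ℝ) (m : ℤ) :
    Complex.exp (2 * Real.pi * Complex.I * ((x + m : ℝ) : ℂ)) =
      Complex.exp (2 * Real.pi * Complex.I * x) := by
  rw [e_add, e_int, mul_one]

/-- `e(θ) ≠ 1` when `θ ∉ ℤ`: the tree's `FloorMultipleUD.exp_ne_one_of_ne_int`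
(`FloorMultipleSequenceUD`); deprecated restatement (dedup-01113, 2026-08-16). [folklore] -/
@[deprecated FloorMultipleUD.exp_ne_one_of_ne_int (since := "2026-08-16")]
theorem e_ne_one {θ : ℝ} (hθ : ∀ m : ℤ, θ ≠ m) :
    Complex.exp (2 * Real.pi * Complex.I * θ) ≠ 1 :=
  FloorMultipleUD.exp_ne_one_of_ne_int hθ

/-- `conj e(x) = e(-x)`. [folklore] -/
theorem e_conj (x : ℝ) : conj (Complex.exp (2 * Real.pi * Complex.I * x)) =
    Complex.exp (2 * Real.pi * Complex.I * ((-x : ℝ) : ℂ)) := by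
  rw [← Complex.exp_conj]
  congr 1
  simp only [map_mul, Complex.conj_ofReal, Complex.conj_I, map_ofNat]
  push_cast
  ring

/-- `e(x - y) = e(x) conj e(y)`. [folklore] -/
theorem e_sub (x y : ℝ) : Complex.exp (2 * Real.pi * Complex.I * ((x - y : ℝ) : ℂ)) =
    Complex.exp (2 * Real.pi * Complex.I * x) *
      conj (Complex.exp (2 * Real.pi * Complex.I * y)) := by
  rw [e_conj, ← e_add]
  congr 2

/-- `e((n + 1)θ) = e(θ) e(nθ)`. [folklore] -/
theorem e_linear_succ (θ : ℝ) (n : ℤ) :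
    Complex.exp (2 * Real.pi * Complex.I * ((((n + 1 : ℤ) : ℝ) * θ : ℝ) : ℂ)) =
      Complex.exp (2 * Real.pi * Complex.I * θ) *
        Complex.exp (2 * Real.pi * Complex.I * ((n * θ : ℝ) : ℂ)) := by
  rw [show ((((n + 1 : ℤ) : ℝ) * θ : ℝ) : ℂ) = ((θ + n * θ : ℝ) : ℂ) by push_cast; ring, e_add]

/-- **The finitary estimate behind Weyl's degree-one theorem along Følner sets**:
`|e(θ) - 1| · |Σ_{n ∈ A} e(nθ)| ≤ |A ∆ (A + 1)|` (the geometric-sum trick, set form). [folklore] -/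
theorem norm_sum_e_linear_le (θ : ℝ) (A : Finset ℤ) :
    ‖Complex.exp (2 * Real.pi * Complex.I * θ) - 1‖ *
      ‖∑ n ∈ A, Complex.exp (2 * Real.pi * Complex.I * ((n * θ : ℝ) : ℂ))‖ ≤
      (A ∆ (A.image fun n => n + 1)).card := by
  have h1 := norm_sum_shift_sub_sum_le (fun n => norm_e_le ((n : ℤ) * θ)) A 1
  have h2 : ∑ n ∈ A, Complex.exp (2 * Real.pi * Complex.I * ((((n + 1 : ℤ) : ℝ) * θ : ℝ) : ℂ)) -
      ∑ n ∈ A, Complex.exp (2 * Real.pi * Complex.I * ((n * θ : ℝ) : ℂ)) =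
      (Complex.exp (2 * Real.pi * Complex.I * θ) - 1) *
        ∑ n ∈ A, Complex.exp (2 * Real.pi * Complex.I * ((n * θ : ℝ) : ℂ)) := by
    rw [sub_mul, one_mul, Finset.mul_sum]
    congr 1
    exact Finset.sum_congr rfl fun n _ => e_linear_succ θ n
  rw [h2, norm_mul] at h1
  exact h1

/-! ### Van der Corput's inequality over a finite set of integers -/

section VdC

variable {a : ℤ → ℂ}

/-- `|a(m) conj a(n)| ≤ 1` for `1`-bounded `a`. [folklore] -/
theorem norm_mul_conj_le (ha : ∀ n, ‖a n‖ ≤ 1) (m n : ℤ) : ‖a m * conj (a n)‖ ≤ 1 := by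
  rw [norm_mul, RCLike.norm_conj]
  calc ‖a m‖ * ‖a n‖ ≤ 1 * 1 := mul_le_mul (ha _) (ha _) (norm_nonneg _) zero_le_one
    _ = 1 := one_mul 1

/-- `H · Σ_A a = Σ_A Σ_{h<H} a(· + h) + Σ_{h<H} (Σ_A a - Σ_A a(· + h))`. [folklore] -/
theorem vdC_decomp (a : ℤ → ℂ) (A : Finset ℤ) (H : ℕ) :
    (H : ℂ) * ∑ n ∈ A, a n =
      ∑ n ∈ A, ∑ h ∈ range H, a (n + h) +
        ∑ h ∈ range H, (∑ n ∈ A, a n - ∑ n ∈ A, a (n + h)) := by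
  rw [Finset.sum_comm, ← Finset.sum_add_distrib]
  simp only [add_sub_cancel, Finset.sum_const, Finset.card_range, nsmul_eq_mul]

/-- `H |Σ_A a| ≤ |Σ_A Σ_{h<H} a(· + h)| + Σ_{h<H} |A ∆ (A + h)|`. [folklore] -/
theorem vdC_norm_le (ha : ∀ n, ‖a n‖ ≤ 1) (A : Finset ℤ) (H : ℕ) :
    (H : ℝ) * ‖∑ n ∈ A, a n‖ ≤ ‖∑ n ∈ A, ∑ h ∈ range H, a (n + h)‖ +
      ∑ h ∈ range H, ((A ∆ (A.image fun n => n + (h : ℤ))).card : ℝ) := by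
  have h0 := congrArg (fun z : ℂ => ‖z‖) (vdC_decomp a A H)
  simp only [norm_mul, Complex.norm_natCast] at h0
  rw [h0]
  refine (norm_add_le _ _).trans (add_le_add le_rfl ?_)
  refine (norm_sum_le _ _).trans (Finset.sum_le_sum fun h _ => ?_)
  rw [← norm_neg, neg_sub]
  exact norm_sum_shift_sub_sum_le ha A h

/-- Cauchy–Schwarz in the form `|Σ_A b|² ≤ |A| Σ_A |b|²`. [folklore] -/
theorem norm_sum_sq_le (A : Finset ℤ) (b : ℤ → ℂ) :
    ‖∑ n ∈ A, b n‖ ^ 2 ≤ A.card * ∑ n ∈ A, ‖b n‖ ^ 2 :=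
  calc ‖∑ n ∈ A, b n‖ ^ 2 ≤ (∑ n ∈ A, ‖b n‖) ^ 2 := by
        gcongr
        exact norm_sum_le _ _
    _ ≤ A.card * ∑ n ∈ A, ‖b n‖ ^ 2 := sq_sum_le_card_mul_sum_sq

/-- `|Σ_h z_h|² = Re Σ_{h,h'} z_h conj z_{h'}`. [folklore] -/
theorem norm_sum_sq_eq_re (s : Finset ℕ) (z : ℕ → ℂ) :
    ‖∑ h ∈ s, z h‖ ^ 2 = (∑ h ∈ s, ∑ h' ∈ s, z h * conj (z h')).re := by
  have h1 : ∑ h ∈ s, ∑ h' ∈ s, z h * conj (z h') = (∑ h ∈ s, z h) * conj (∑ h ∈ s, z h) := by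
    rw [map_sum, Finset.sum_mul_sum]
  rw [h1, Complex.mul_conj, Complex.ofReal_re, Complex.normSq_eq_norm_sq]

/-- `Σ_A |Σ_{h<H} a(· + h)|² ≤ Σ_{h,h'<H} |Σ_A a(· + h) conj a(· + h')|`. [folklore] -/
theorem sum_norm_sq_shifts_le (a : ℤ → ℂ) (A : Finset ℤ) (H : ℕ) :
    ∑ n ∈ A, ‖∑ h ∈ range H, a (n + h)‖ ^ 2 ≤
      ∑ h ∈ range H, ∑ h' ∈ range H, ‖∑ n ∈ A, a (n + h) * conj (a (n + h'))‖ := by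
  calc ∑ n ∈ A, ‖∑ h ∈ range H, a (n + h)‖ ^ 2
      = ∑ n ∈ A, (∑ h ∈ range H, ∑ h' ∈ range H, a (n + h) * conj (a (n + h'))).re :=
        Finset.sum_congr rfl fun n _ => norm_sum_sq_eq_re _ _
    _ = (∑ h ∈ range H, ∑ h' ∈ range H, ∑ n ∈ A, a (n + h) * conj (a (n + h'))).re := by
        rw [← Complex.re_sum, Finset.sum_comm]
        congr 1
        exact Finset.sum_congr rfl fun h _ => Finset.sum_comm
    _ ≤ ∑ h ∈ range H, ∑ h' ∈ range H, ‖∑ n ∈ A, a (n + h) * conj (a (n + h'))‖ := by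
        rw [Complex.re_sum]
        refine Finset.sum_le_sum fun h _ => ?_
        rw [Complex.re_sum]
        exact Finset.sum_le_sum fun h' _ => Complex.re_le_norm _

/-- A pair correlation `Σ_A a(· + h) conj a(· + h')` is, up to `|A ∆ (A + h')|`, the correlation
`Σ_A a(· + (h - h')) conj a(·)`. [folklore] -/
theorem norm_pairCorr_sub_corr_le (ha : ∀ n, ‖a n‖ ≤ 1) (A : Finset ℤ) (h h' : ℤ) :
    ‖∑ n ∈ A, a (n + h) * conj (a (n + h')) - ∑ n ∈ A, a (n + (h - h')) * conj (a n)‖ ≤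
      (A ∆ (A.image fun n => n + h')).card := by
  have h1 := norm_sum_shift_sub_sum_le (f := fun m => a (m + (h - h')) * conj (a m))
    (fun m => norm_mul_conj_le ha _ _) A h'
  have h2 : ∀ n : ℤ, a (n + h) * conj (a (n + h')) = a (n + h' + (h - h')) * conj (a (n + h')) := by
    intro n; congr 2; ring
  simp_rw [h2]
  exact h1

/-- **Van der Corput's inequality over a finite set of integers** (Følner form): for `1`-bounded
`a`, non-empty `A` and `H ≥ 1`,
`|A|⁻¹ |Σ_A a| ≤ H⁻¹ ( √(Σ_{h,h'<H} (|A|⁻¹ |Σ_A a(·+(h-h')) conj a| + |A ∆ (A+h')|/|A|))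
  + Σ_{h<H} |A ∆ (A+h)|/|A| )`. [folklore] -/
theorem vdC_avg_le (ha : ∀ n, ‖a n‖ ≤ 1) {A : Finset ℤ} (hA : A.Nonempty) {H : ℕ} (hH : 0 < H) :
    ‖∑ n ∈ A, a n‖ / A.card ≤
      (H : ℝ)⁻¹ * (Real.sqrt (∑ h ∈ range H, ∑ h' ∈ range H,
          (‖∑ n ∈ A, a (n + ((h : ℤ) - h')) * conj (a n)‖ / A.card +
            ((A ∆ (A.image fun n => n + (h' : ℤ))).card : ℝ) / A.card)) +
        ∑ h ∈ range H, ((A ∆ (A.image fun n => n + (h : ℤ))).card : ℝ) / A.card) := by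
  have hM : (0 : ℝ) < A.card := by exact_mod_cast hA.card_pos
  have hHr : (0 : ℝ) < H := by exact_mod_cast hH
  set X : ℝ := ∑ h ∈ range H, ∑ h' ∈ range H,
      (‖∑ n ∈ A, a (n + ((h : ℤ) - h')) * conj (a n)‖ +
        ((A ∆ (A.image fun n => n + (h' : ℤ))).card : ℝ)) with hX
  set E : ℝ := ∑ h ∈ range H, ((A ∆ (A.image fun n => n + (h : ℤ))).card : ℝ) with hE
  have hT : ‖∑ n ∈ A, ∑ h ∈ range H, a (n + h)‖ ≤ Real.sqrt (A.card * X) := by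
    rw [← Real.sqrt_sq (norm_nonneg _)]
    apply Real.sqrt_le_sqrt
    refine (norm_sum_sq_le A _).trans ?_
    gcongr
    refine (sum_norm_sq_shifts_le a A H).trans ?_
    refine Finset.sum_le_sum fun h _ => Finset.sum_le_sum fun h' _ => ?_
    refine (norm_le_insert' _ (∑ n ∈ A, a (n + ((h : ℤ) - h')) * conj (a n))).trans ?_
    gcongr
    exact norm_pairCorr_sub_corr_le ha A h h'
  have hmain : (H : ℝ) * ‖∑ n ∈ A, a n‖ ≤ Real.sqrt (A.card * X) + E :=
    (vdC_norm_le ha A H).trans (add_le_add hT le_rfl)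
  have hsqrt : Real.sqrt (A.card * X) / A.card = Real.sqrt (X / A.card) := by
    rw [div_eq_iff hM.ne', ← Real.sqrt_sq hM.le,
      ← Real.sqrt_mul' _ (by positivity : (0 : ℝ) ≤ (A.card : ℝ) ^ 2), Real.sqrt_sq hM.le]
    congr 1
    field_simp
  have hXdiv : X / A.card = ∑ h ∈ range H, ∑ h' ∈ range H,
      (‖∑ n ∈ A, a (n + ((h : ℤ) - h')) * conj (a n)‖ / A.card +
        ((A ∆ (A.image fun n => n + (h' : ℤ))).card : ℝ) / A.card) := by
    rw [hX, Finset.sum_div]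
    refine Finset.sum_congr rfl fun h _ => ?_
    rw [Finset.sum_div]
    refine Finset.sum_congr rfl fun h' _ => ?_
    rw [add_div]
  have hEdiv : E / A.card =
      ∑ h ∈ range H, ((A ∆ (A.image fun n => n + (h : ℤ))).card : ℝ) / A.card := by
    rw [hE, Finset.sum_div]
  rw [← hXdiv, ← hEdiv, ← hsqrt, ← add_div, le_inv_mul_iff₀ hHr, mul_div_assoc']
  exact div_le_div_of_nonneg_right hmain hM.le

end VdC

/-! ### Differencing a polynomial: `p(X + h) - p(X)` -/

/-- For `deg p ≤ d + 1` and `N ≥ d`, the Hasse derivative `D_N p` is linear: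
`(D_N p)(h) = [X^N]p + (N + 1) [X^{N+1}]p · h`. [folklore] -/
theorem eval_hasseDeriv_of_natDegree_le {p : ℝ[X]} {d N : ℕ} (hp : p.natDegree ≤ d + 1)
    (hN : d ≤ N) (h : ℝ) :
    (hasseDeriv N p).eval h = p.coeff N + ((N + 1 : ℕ) : ℝ) * p.coeff (N + 1) * h := by
  have hdeg : (hasseDeriv N p).natDegree < 2 := by
    have := natDegree_hasseDeriv_le p N
    omega
  rw [eval_eq_sum_range' hdeg, Finset.sum_range_succ, Finset.sum_range_one, hasseDeriv_coeff,
    hasseDeriv_coeff, zero_add, Nat.choose_self, show 1 + N = N + 1 from add_comm 1 N,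
    Nat.choose_succ_self_right]
  push_cast
  ring

/-- If `deg p ≤ d + 1` then `deg (p(X + h) - p(X)) ≤ d`. [folklore] -/
theorem natDegree_taylor_sub_le {p : ℝ[X]} {d : ℕ} (hp : p.natDegree ≤ d + 1) (h : ℝ) :
    (taylor h p - p).natDegree ≤ d := by
  rw [natDegree_le_iff_coeff_eq_zero]
  intro N hN
  rw [coeff_sub, taylor_coeff, eval_hasseDeriv_of_natDegree_le hp hN.le,
    coeff_eq_zero_of_natDegree_lt (show p.natDegree < N + 1 by omega)]
  ring

/-- The `X^d`-coefficient of `p(X + h) - p(X)` is `(d + 1) h · [X^{d+1}] p` when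
`deg p ≤ d + 1`. [folklore] -/
theorem coeff_taylor_sub {p : ℝ[X]} {d : ℕ} (hp : p.natDegree ≤ d + 1) (h : ℝ) :
    (taylor h p - p).coeff d = ((d + 1 : ℕ) : ℝ) * h * p.coeff (d + 1) := by
  rw [coeff_sub, taylor_coeff, eval_hasseDeriv_of_natDegree_le hp le_rfl]
  ring

/-- `(p(X + h) - p(X))(x) = p(x + h) - p(x)`. [folklore] -/
theorem eval_taylor_sub (p : ℝ[X]) (h x : ℝ) :
    (taylor h p - p).eval x = p.eval (x + h) - p.eval x := by
  rw [eval_sub, taylor_eval]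

/-- Removing the top monomial lowers the degree bound. [folklore] -/
theorem natDegree_sub_C_mul_X_pow_le {p : ℝ[X]} {d : ℕ} (hp : p.natDegree ≤ d + 1) :
    (p - C (p.coeff (d + 1)) * X ^ (d + 1)).natDegree ≤ d := by
  rw [natDegree_le_iff_coeff_eq_zero]
  intro N hN
  rw [coeff_sub, coeff_C_mul, coeff_X_pow]
  rcases eq_or_lt_of_le (show d + 1 ≤ N by omega) with h | h
  · subst h; simp
  · rw [if_neg (by omega), mul_zero, sub_zero]
    exact coeff_eq_zero_of_natDegree_lt (by omega)

/-! ### Finite Fourier expansion of periodic sequences -/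

/-- **Orthogonality of the `q`-th roots of unity**: `Σ_{s<q} e(sm/q) = q · [q ∣ m]`. [folklore] -/
theorem sum_e_div_nat {q : ℕ} (hq : 0 < q) (m : ℤ) :
    ∑ s ∈ range q, Complex.exp (2 * Real.pi * Complex.I * (((s : ℝ) * m / q : ℝ) : ℂ)) =
      if (q : ℤ) ∣ m then (q : ℂ) else 0 := by
  have hq' : (q : ℝ) ≠ 0 := by positivity
  have hz : ∀ s : ℕ, Complex.exp (2 * Real.pi * Complex.I * (((s : ℝ) * m / q : ℝ) : ℂ)) =
      Complex.exp (2 * Real.pi * Complex.I * ((m / q : ℝ) : ℂ)) ^ s := by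
    intro s
    rw [← Complex.exp_nat_mul]
    congr 1
    push_cast
    ring
  simp_rw [hz]
  split_ifs with hdvd
  · obtain ⟨c, hc⟩ := hdvd
    have h1 : Complex.exp (2 * Real.pi * Complex.I * ((m / q : ℝ) : ℂ)) = 1 := by
      rw [hc, show (((q : ℤ) * c : ℤ) / q : ℝ) = (c : ℝ) by push_cast; field_simp]
      exact e_int c
    simp_rw [h1, one_pow]
    simp
  · have hne : Complex.exp (2 * Real.pi * Complex.I * ((m / q : ℝ) : ℂ)) ≠ 1 := by
      apply FloorMultipleUD.exp_ne_one_of_ne_int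
      intro c hc
      apply hdvd
      refine ⟨c, ?_⟩
      field_simp at hc
      have hc' : (m : ℝ) = q * c := by linarith [hc]
      exact_mod_cast hc'
    have hqC : (q : ℂ) ≠ 0 := by exact_mod_cast hq.ne'
    rw [geom_sum_eq hne, ← Complex.exp_nat_mul,
      show (q : ℂ) * (2 * Real.pi * Complex.I * ((m / q : ℝ) : ℂ)) =
        2 * Real.pi * Complex.I * ((m : ℝ) : ℂ) by push_cast; field_simp, e_int]
    simp

/-- **Finite Fourier expansion** of a `q`-periodic sequence `F : ℤ → ℂ`:
`F(n) = Σ_{s<q} ĉ_s e(sn/q)` with `ĉ_s = q⁻¹ Σ_{r<q} F(r) e(-sr/q)`. [folklore] -/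
theorem periodic_expansion {q : ℕ} (hq : 0 < q) {F : ℤ → ℂ} (hF : Function.Periodic F (q : ℤ))
    (n : ℤ) :
    F n = ∑ s ∈ range q, ((q : ℂ)⁻¹ * ∑ r ∈ range q,
      F r * Complex.exp (2 * Real.pi * Complex.I * ((-((s : ℝ) * r / q) : ℝ) : ℂ))) *
        Complex.exp (2 * Real.pi * Complex.I * (((s : ℝ) * n / q : ℝ) : ℂ)) := by
  have hq0 : (q : ℤ) ≠ 0 := by exact_mod_cast hq.ne'
  have hqC : (q : ℂ) ≠ 0 := by exact_mod_cast hq.ne'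
  symm
  calc ∑ s ∈ range q, ((q : ℂ)⁻¹ * ∑ r ∈ range q,
        F r * Complex.exp (2 * Real.pi * Complex.I * ((-((s : ℝ) * r / q) : ℝ) : ℂ))) *
          Complex.exp (2 * Real.pi * Complex.I * (((s : ℝ) * n / q : ℝ) : ℂ))
      = ∑ s ∈ range q, ∑ r ∈ range q, (q : ℂ)⁻¹ * (F r *
          Complex.exp (2 * Real.pi * Complex.I * (((s : ℝ) * ((n - r : ℤ) : ℝ) / q : ℝ) : ℂ))) := by
        refine Finset.sum_congr rfl fun s _ => ?_
        rw [Finset.mul_sum, Finset.sum_mul]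
        refine Finset.sum_congr rfl fun r _ => ?_
        rw [mul_assoc, mul_assoc, ← e_add]
        congr 4
        push_cast
        ring
    _ = ∑ r ∈ range q, (q : ℂ)⁻¹ * (F r * ∑ s ∈ range q,
          Complex.exp (2 * Real.pi * Complex.I * (((s : ℝ) * ((n - r : ℤ) : ℝ) / q : ℝ) : ℂ))) := by
        rw [Finset.sum_comm]
        simp_rw [Finset.mul_sum]
    _ = ∑ r ∈ range q, (q : ℂ)⁻¹ * (F r * if (q : ℤ) ∣ (n - r) then (q : ℂ) else 0) := by
        refine Finset.sum_congr rfl fun r _ => ?_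
        rw [sum_e_div_nat hq (n - r)]
    _ = F n := by
        have hmod0 : 0 ≤ n % q := Int.emod_nonneg _ hq0
        have hmodq : n % q < q := Int.emod_lt_of_pos _ (by exact_mod_cast hq)
        set r₀ : ℕ := (n % q).toNat with hr₀
        have hr₀Z : (r₀ : ℤ) = n % q := Int.toNat_of_nonneg hmod0
        have hr₀q : r₀ < q := by omega
        rw [Finset.sum_eq_single r₀]
        · have hdvd : (q : ℤ) ∣ n - r₀ := by
            rw [hr₀Z, Int.dvd_iff_emod_eq_zero, Int.sub_emod, Int.emod_emod, sub_self,
              Int.zero_emod]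
          have hper : F (n - (n / q) • (q : ℤ)) = F n := hF.sub_zsmul_eq (n / q)
          rw [zsmul_eq_mul, Int.cast_id] at hper
          rw [if_pos hdvd, ← mul_assoc, mul_comm, ← mul_assoc, mul_inv_cancel₀ hqC, one_mul, hr₀Z,
            Int.emod_def, show n - (q : ℤ) * (n / q) = n - (n / q) * q by rw [mul_comm], hper]
        · intro r hr hne
          rw [if_neg, mul_zero, mul_zero]
          intro hdvd
          apply hne
          have h1 : n % q = (r : ℤ) % q :=
            Int.emod_eq_emod_iff_emod_sub_eq_zero.2 (Int.emod_eq_zero_of_dvd hdvd)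
          rw [Int.emod_eq_of_lt (a := (r : ℤ)) (by positivity)
            (by exact_mod_cast Finset.mem_range.1 hr)] at h1
          have : (r : ℤ) = r₀ := by rw [hr₀Z, h1]
          exact_mod_cast this
        · intro h
          exact absurd (Finset.mem_range.2 hr₀q) h

/-- `n ↦ e((m/q) n^j)` is `q`-periodic on `ℤ` (`q ∣ (n + q)^j - n^j`). [folklore] -/
theorem periodic_e_rat_mul_pow (m : ℤ) {q : ℕ} (hq : 0 < q) (j : ℕ) :
    Function.Periodic (fun n : ℤ =>
      Complex.exp (2 * Real.pi * Complex.I * (((m / q : ℝ) * (n : ℝ) ^ j : ℝ) : ℂ))) (q : ℤ) := by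
  intro n
  obtain ⟨K, hK⟩ : (q : ℤ) ∣ (n + q) ^ j - n ^ j := by
    have := (Commute.all (n + q : ℤ) n).sub_dvd_pow_sub_pow j
    simpa using this
  have hq' : (q : ℝ) ≠ 0 := by positivity
  have h1 : ((m / q : ℝ) * ((n + q : ℤ) : ℝ) ^ j : ℝ) =
      (m / q : ℝ) * (n : ℝ) ^ j + ((m * K : ℤ) : ℝ) := by
    have h2 : (((n + q) ^ j : ℤ) : ℝ) = ((n ^ j : ℤ) : ℝ) + (q : ℝ) * K := by
      rw [show (n + q) ^ j = n ^ j + q * K by linarith]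
      push_cast
      ring
    push_cast at h2 ⊢
    rw [h2]
    field_simp
  simp only
  rw [h1, e_add_int]

end FoelnerWeyl

open FoelnerWeyl

/-! ### Følner sequences of `ℤ` -/

namespace IsFoelnerSeq

variable {Φ : ℕ → Finset ℤ}

/-- Følner sets are eventually non-empty (first clause of the definition).
[cite: BergelsonLeibman2007, §0.21] -/
theorem eventually_nonempty (hΦ : IsFoelnerSeq Φ) : ∀ᶠ N in atTop, (Φ N).Nonempty := hΦ.1

/-- Følner sets eventually have positive cardinality. [cite: BergelsonLeibman2007, §0.21] -/
theorem eventually_card_pos (hΦ : IsFoelnerSeq Φ) : ∀ᶠ N in atTop, 0 < ((Φ N).card : ℝ) := by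
  filter_upwards [hΦ.eventually_nonempty] with N hN
  exact_mod_cast hN.card_pos

/-- Asymptotic invariance under the shift by `1` (second clause of the definition).
[cite: BergelsonLeibman2007, §0.21] -/
theorem tendsto_shift_one (hΦ : IsFoelnerSeq Φ) :
    Tendsto (fun N => (((Φ N) ∆ ((Φ N).image fun n => n + 1)).card : ℝ) / (Φ N).card) atTop
      (𝓝 0) := hΦ.2

/-- **Følner sets are asymptotically invariant under every shift**:
`|Φ_N ∆ (Φ_N + k)| / |Φ_N| → 0` for all `k : ℤ` (so the generator-`1` definition is the usual
Følner condition for `ℤ`). [cite: BergelsonLeibman2007, §0.21] -/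
theorem tendsto_shift (hΦ : IsFoelnerSeq Φ) (k : ℤ) :
    Tendsto (fun N => (((Φ N) ∆ ((Φ N).image fun n => n + k)).card : ℝ) / (Φ N).card) atTop
      (𝓝 0) := by
  have hk : Tendsto (fun N => (k.natAbs : ℝ) *
      ((((Φ N) ∆ ((Φ N).image fun n => n + 1)).card : ℝ) / (Φ N).card)) atTop (𝓝 0) := by
    simpa using hΦ.tendsto_shift_one.const_mul (k.natAbs : ℝ)
  refine squeeze_zero (fun N => by positivity) (fun N => ?_) hk
  rw [← mul_div_assoc]
  gcongr
  exact_mod_cast card_symmDiff_shift_int_le (Φ N) k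

/-- **Følner sets exhaust**: `|Φ_N| → ∞`. [cite: BergelsonLeibman2007, §0.21] -/
theorem tendsto_card_atTop (hΦ : IsFoelnerSeq Φ) :
    Tendsto (fun N => ((Φ N).card : ℝ)) atTop atTop := by
  have hinv : Tendsto (fun N => ((Φ N).card : ℝ)⁻¹) atTop (𝓝 0) := by
    refine squeeze_zero' (Eventually.of_forall fun N => by positivity) ?_ hΦ.tendsto_shift_one
    filter_upwards [hΦ.eventually_nonempty] with N hN
    rw [inv_eq_one_div]
    gcongr
    exact_mod_cast one_le_card_symmDiff_shift hN
  have hinv' : Tendsto (fun N => ((Φ N).card : ℝ)⁻¹) atTop (𝓝[>] 0) := by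
    refine tendsto_nhdsWithin_iff.2 ⟨hinv, ?_⟩
    filter_upwards [hΦ.eventually_card_pos] with N hN
    exact inv_pos.2 hN
  have h := tendsto_inv_nhdsGT_zero.comp hinv'
  simpa [Function.comp_def, inv_inv] using h

/-- Averages of a constant along a Følner sequence converge to the constant. [folklore] -/
theorem tendsto_avg_const (hΦ : IsFoelnerSeq Φ) (c : ℂ) :
    Tendsto (fun N => ((Φ N).card : ℂ)⁻¹ * ∑ _n ∈ Φ N, c) atTop (𝓝 c) := by
  refine tendsto_const_nhds.congr' ?_
  filter_upwards [hΦ.eventually_nonempty] with N hN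
  have hc : ((Φ N).card : ℂ) ≠ 0 := by exact_mod_cast hN.card_pos.ne'
  rw [Finset.sum_const, nsmul_eq_mul, ← mul_assoc, inv_mul_cancel₀ hc, one_mul]

/-- **Degree one, along Følner sequences.** If `θ ∉ ℤ` then
`|Φ_N|⁻¹ Σ_{n ∈ Φ_N} e(nθ) → 0` for every Følner sequence `Φ` of `ℤ` (geometric-sum trick in
set form, `FoelnerWeyl.norm_sum_e_linear_le`; for irrational `θ` this is the case `r = 1` of
Weyl 1916, Satz 9). [folklore] -/
theorem tendsto_avg_e_linear (hΦ : IsFoelnerSeq Φ) {θ : ℝ} (hθ : ∀ m : ℤ, θ ≠ m) :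
    Tendsto (fun N => ((Φ N).card : ℂ)⁻¹ *
      ∑ n ∈ Φ N, Complex.exp (2 * Real.pi * Complex.I * ((n * θ : ℝ) : ℂ))) atTop (𝓝 0) := by
  set c : ℝ := ‖Complex.exp (2 * Real.pi * Complex.I * θ) - 1‖ with hc
  have hcpos : 0 < c := norm_pos_iff.2 (sub_ne_zero.2 (FloorMultipleUD.exp_ne_one_of_ne_int hθ))
  rw [tendsto_zero_iff_norm_tendsto_zero]
  have hbound : ∀ N, ‖((Φ N).card : ℂ)⁻¹ *
      ∑ n ∈ Φ N, Complex.exp (2 * Real.pi * Complex.I * ((n * θ : ℝ) : ℂ))‖ ≤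
      c⁻¹ * ((((Φ N) ∆ ((Φ N).image fun n => n + 1)).card : ℝ) / (Φ N).card) := by
    intro N
    rw [norm_avg_eq, ← mul_div_assoc]
    gcongr
    rw [le_inv_mul_iff₀ hcpos]
    exact norm_sum_e_linear_le θ (Φ N)
  refine squeeze_zero (fun N => norm_nonneg _) hbound ?_
  simpa using hΦ.tendsto_shift_one.const_mul c⁻¹

/-- **Van der Corput's difference theorem along Følner sequences of `ℤ`.** If `a : ℤ → ℂ` is
bounded by `1` and for every `k ≠ 0` the correlation averages
`|Φ_N|⁻¹ Σ_{n ∈ Φ_N} a(n + k) conj a(n)` tend to `0`, then `|Φ_N|⁻¹ Σ_{n ∈ Φ_N} a(n) → 0`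
(from `FoelnerWeyl.vdC_avg_le`: `limsup ≤ 1/√H` for every `H`). [folklore] -/
theorem tendsto_avg_zero_of_corr (hΦ : IsFoelnerSeq Φ) {a : ℤ → ℂ} (ha : ∀ n, ‖a n‖ ≤ 1)
    (hcorr : ∀ k : ℤ, k ≠ 0 →
      Tendsto (fun N => ((Φ N).card : ℂ)⁻¹ * ∑ n ∈ Φ N, a (n + k) * conj (a n)) atTop (𝓝 0)) :
    Tendsto (fun N => ((Φ N).card : ℂ)⁻¹ * ∑ n ∈ Φ N, a n) atTop (𝓝 0) := by
  rw [NormedAddGroup.tendsto_nhds_zero]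
  intro ε hε
  obtain ⟨H, hH⟩ := exists_nat_gt (1 / ε ^ 2)
  have hHpos : (0 : ℝ) < H := lt_trans (by positivity) hH
  have hH0 : 0 < H := by exact_mod_cast hHpos
  have hD : ∀ k : ℤ, Tendsto (fun N =>
      (((Φ N) ∆ ((Φ N).image fun n => n + k)).card : ℝ) / (Φ N).card) atTop (𝓝 0) :=
    hΦ.tendsto_shift
  have hC : ∀ k : ℤ, k ≠ 0 → Tendsto (fun N =>
      ‖∑ n ∈ Φ N, a (n + k) * conj (a n)‖ / (Φ N).card) atTop (𝓝 0) := by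
    intro k hk
    have h1 := tendsto_zero_iff_norm_tendsto_zero.1 (hcorr k hk)
    simpa only [norm_avg_eq] using h1
  set δ : ℕ → ℝ := fun N => ∑ h ∈ range H, ∑ h' ∈ range H,
      ((if h = h' then (1 : ℝ) else ‖∑ n ∈ Φ N, a (n + ((h : ℤ) - h')) * conj (a n)‖ / (Φ N).card) +
        (((Φ N) ∆ ((Φ N).image fun n => n + (h' : ℤ))).card : ℝ) / (Φ N).card) with hδ_def
  set η : ℕ → ℝ := fun N => ∑ h ∈ range H,
      (((Φ N) ∆ ((Φ N).image fun n => n + (h : ℤ))).card : ℝ) / (Φ N).card with hη_def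
  have hL : ∑ h ∈ range H, ∑ h' ∈ range H, ((if h = h' then (1 : ℝ) else 0) + 0) = H := by
    have h1 : ∀ h ∈ range H, ∑ h' ∈ range H, ((if h = h' then (1 : ℝ) else 0) + 0) = 1 := by
      intro h hh
      simp [Finset.sum_ite_eq, hh]
    rw [Finset.sum_congr rfl h1]
    simp
  have hδ : Tendsto δ atTop (𝓝 (H : ℝ)) := by
    rw [← hL]
    refine tendsto_finsetSum _ fun h _ => tendsto_finsetSum _ fun h' _ => ?_
    refine Tendsto.add ?_ (hD _)
    split_ifs with hhh
    · exact tendsto_const_nhds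
    · exact hC _ (by omega)
  have hη : Tendsto η atTop (𝓝 0) := by
    have h0 : (0 : ℝ) = ∑ h ∈ range H, (0 : ℝ) := by simp
    rw [h0]
    exact tendsto_finsetSum _ fun h _ => hD _
  have hR : Tendsto (fun N => (H : ℝ)⁻¹ * (Real.sqrt (δ N) + η N)) atTop
      (𝓝 ((H : ℝ)⁻¹ * (Real.sqrt H + 0))) :=
    (hδ.sqrt.add hη).const_mul _
  have hlim : (H : ℝ)⁻¹ * (Real.sqrt H + 0) < ε := by
    rw [add_zero]
    have h1 : 1 / ε < Real.sqrt H := by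
      rw [← Real.sqrt_sq (by positivity : (0 : ℝ) ≤ 1 / ε)]
      apply Real.sqrt_lt_sqrt (by positivity)
      rw [div_pow, one_pow]
      exact hH
    have h2 : (H : ℝ)⁻¹ * Real.sqrt H = 1 / Real.sqrt H := by
      rw [eq_div_iff (Real.sqrt_pos.2 hHpos).ne', mul_assoc, Real.mul_self_sqrt hHpos.le,
        inv_mul_cancel₀ hHpos.ne']
    rw [h2, div_lt_iff₀ (Real.sqrt_pos.2 hHpos), ← div_lt_iff₀' hε]
    exact h1
  have hev : ∀ᶠ N in atTop, (H : ℝ)⁻¹ * (Real.sqrt (δ N) + η N) < ε :=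
    hR.eventually_lt_const hlim
  filter_upwards [hev, hΦ.eventually_nonempty] with N hN hne
  refine lt_of_le_of_lt ?_ hN
  rw [norm_avg_eq]
  refine (vdC_avg_le ha hne hH0).trans ?_
  have hM : (0 : ℝ) < (Φ N).card := by exact_mod_cast hne.card_pos
  have hterm : ∀ h h' : ℕ,
      ‖∑ n ∈ Φ N, a (n + ((h : ℤ) - h')) * conj (a n)‖ / (Φ N).card ≤
        (if h = h' then (1 : ℝ)
          else ‖∑ n ∈ Φ N, a (n + ((h : ℤ) - h')) * conj (a n)‖ / (Φ N).card) := by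
    intro h h'
    split_ifs with hhh
    · rw [div_le_one hM]
      exact norm_sum_le_card (fun n => norm_mul_conj_le ha _ _) (Φ N)
    · exact le_rfl
  have hδN : Real.sqrt (∑ h ∈ range H, ∑ h' ∈ range H,
      (‖∑ n ∈ Φ N, a (n + ((h : ℤ) - h')) * conj (a n)‖ / (Φ N).card +
        (((Φ N) ∆ ((Φ N).image fun n => n + (h' : ℤ))).card : ℝ) / (Φ N).card)) ≤
      Real.sqrt (δ N) := by
    apply Real.sqrt_le_sqrt
    exact Finset.sum_le_sum fun h _ => Finset.sum_le_sum fun h' _ => add_le_add (hterm h h') le_rfl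
  have hηN : ∑ h ∈ range H, (((Φ N) ∆ ((Φ N).image fun n => n + (h : ℤ))).card : ℝ) / (Φ N).card
      = η N := rfl
  rw [hηN]
  gcongr

/-- **Weyl's equidistribution theorem along Følner sequences (vanishing case).** If
`deg p ≤ d + 1` and the coefficient of `X^{d+1}` is irrational, then
`|Φ_N|⁻¹ Σ_{n ∈ Φ_N} e(p(n)) → 0` for every Følner sequence `Φ` of `ℤ` (Weyl 1916, Satz 9 with
its Zusatz, in Følner form; induction on `d` by van der Corput differencing, the difference
`p(X + k) - p(X)` having `X^d`-coefficient `(d + 1) k · [X^{d+1}] p`). [cite: Weyl1916, Satz 9] -/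
theorem tendsto_avg_e_poly_of_irrational (hΦ : IsFoelnerSeq Φ) (d : ℕ) :
    ∀ p : ℝ[X], p.natDegree ≤ d + 1 → Irrational (p.coeff (d + 1)) →
      Tendsto (fun N => ((Φ N).card : ℂ)⁻¹ *
        ∑ n ∈ Φ N, Complex.exp (2 * Real.pi * Complex.I * ((p.eval (n : ℝ) : ℝ) : ℂ)))
        atTop (𝓝 0) := by
  induction d with
  | zero =>
    intro p hp hirr
    have hp1 : p = C (p.coeff 1) * X + C (p.coeff 0) := eq_X_add_C_of_natDegree_le_one (by omega)
    have hθ : ∀ m : ℤ, p.coeff 1 ≠ m := fun m => hirr.ne_int m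
    have key : ∀ n : ℤ, Complex.exp (2 * Real.pi * Complex.I * ((p.eval (n : ℝ) : ℝ) : ℂ)) =
        Complex.exp (2 * Real.pi * Complex.I * ((p.coeff 0 : ℝ) : ℂ)) *
          Complex.exp (2 * Real.pi * Complex.I * ((n * p.coeff 1 : ℝ) : ℂ)) := by
      intro n
      rw [← e_add]
      congr 3
      conv_lhs => rw [hp1]
      simp only [eval_add, eval_mul, eval_C, eval_X]
      ring
    simp_rw [key, ← Finset.mul_sum, mul_left_comm _ (Complex.exp _)]
    simpa using (hΦ.tendsto_avg_e_linear hθ).const_mul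
      (Complex.exp (2 * Real.pi * Complex.I * ((p.coeff 0 : ℝ) : ℂ)))
  | succ d ih =>
    intro p hp hirr
    apply hΦ.tendsto_avg_zero_of_corr (a := fun n : ℤ =>
      Complex.exp (2 * Real.pi * Complex.I * ((p.eval (n : ℝ) : ℝ) : ℂ))) (fun n => norm_e_le _)
    intro k hk
    have hq : ∀ n : ℤ,
        Complex.exp (2 * Real.pi * Complex.I * ((p.eval ((n + k : ℤ) : ℝ) : ℝ) : ℂ)) *
          conj (Complex.exp (2 * Real.pi * Complex.I * ((p.eval (n : ℝ) : ℝ) : ℂ))) =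
        Complex.exp (2 * Real.pi * Complex.I *
          (((taylor (k : ℝ) p - p).eval (n : ℝ) : ℝ) : ℂ)) := by
      intro n
      rw [← e_sub, eval_taylor_sub]
      push_cast
      ring_nf
    simp_rw [hq]
    refine ih (taylor (k : ℝ) p - p) (natDegree_taylor_sub_le hp k) ?_
    rw [coeff_taylor_sub hp]
    rw [show ((d + 1 + 1 : ℕ) : ℝ) * (k : ℝ) * p.coeff (d + 1 + 1) =
      (((d + 1 + 1 : ℕ) * k : ℤ) : ℝ) * p.coeff (d + 1 + 1) by push_cast; ring]
    refine hirr.intCast_mul ?_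
    have : (k : ℤ) ≠ 0 := hk
    positivity

/-- Degree `≤ 1` with a non-integer linear coefficient: the averages vanish. [folklore] -/
theorem tendsto_avg_e_deg_one (hΦ : IsFoelnerSeq Φ) {p : ℝ[X]}
    (hp : p.natDegree ≤ 1) (hθ : ∀ m : ℤ, p.coeff 1 ≠ m) :
    Tendsto (fun N => ((Φ N).card : ℂ)⁻¹ *
      ∑ n ∈ Φ N, Complex.exp (2 * Real.pi * Complex.I * ((p.eval (n : ℝ) : ℝ) : ℂ)))
      atTop (𝓝 0) := by
  have hp1 : p = C (p.coeff 1) * X + C (p.coeff 0) := eq_X_add_C_of_natDegree_le_one hp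
  have key : ∀ n : ℤ, Complex.exp (2 * Real.pi * Complex.I * ((p.eval (n : ℝ) : ℝ) : ℂ)) =
      Complex.exp (2 * Real.pi * Complex.I * ((p.coeff 0 : ℝ) : ℂ)) *
        Complex.exp (2 * Real.pi * Complex.I * ((n * p.coeff 1 : ℝ) : ℂ)) := by
    intro n
    rw [← e_add]
    congr 3
    conv_lhs => rw [hp1]
    simp only [eval_add, eval_mul, eval_C, eval_X]
    ring
  simp_rw [key, ← Finset.mul_sum, mul_left_comm _ (Complex.exp _)]
  simpa using (hΦ.tendsto_avg_e_linear hθ).const_mul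
    (Complex.exp (2 * Real.pi * Complex.I * ((p.coeff 0 : ℝ) : ℂ)))

end IsFoelnerSeq

/-! ### Weyl's theorem along Følner sequences: existence and Følner-independence of the limit -/

/-- **Weyl's theorem along Følner sequences, all polynomials of degree `≤ d`.** For every real
polynomial `p` there is `c ∈ ℂ` such that `|Φ_N|⁻¹ Σ_{n ∈ Φ_N} e(p(n)) → c` for EVERY Følner
sequence `Φ` of `ℤ`: `c = 0` as soon as some non-constant coefficient is irrational (Weyl);
otherwise the top coefficient `m/q` gives a `q`-periodic factor `e((m/q)n^d)`, expanded in the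
characters `e(sn/q)` and absorbed into lower-degree polynomials (induction on `d`).
[cite: Weyl1916, Satz 9] -/
theorem exists_tendsto_avg_e_poly (d : ℕ) : ∀ p : ℝ[X], p.natDegree ≤ d →
    ∃ c : ℂ, ∀ Φ : ℕ → Finset ℤ, IsFoelnerSeq Φ →
      Tendsto (fun N => ((Φ N).card : ℂ)⁻¹ *
        ∑ n ∈ Φ N, Complex.exp (2 * Real.pi * Complex.I * ((p.eval (n : ℝ) : ℝ) : ℂ)))
        atTop (𝓝 c) := by
  induction d with
  | zero =>
    intro p hp
    refine ⟨Complex.exp (2 * Real.pi * Complex.I * ((p.coeff 0 : ℝ) : ℂ)), fun Φ hΦ => ?_⟩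
    have hp0 : p = C (p.coeff 0) := eq_C_of_natDegree_le_zero hp
    have key : ∀ n : ℤ, p.eval (n : ℝ) = p.coeff 0 := by
      intro n; conv_lhs => rw [hp0]; simp
    simp_rw [key]
    exact hΦ.tendsto_avg_const _
  | succ d ih =>
    intro p hp
    rcases d with _ | d
    · -- degree ≤ 1
      by_cases hint : ∃ m : ℤ, p.coeff 1 = m
      · obtain ⟨m, hm⟩ := hint
        refine ⟨Complex.exp (2 * Real.pi * Complex.I * ((p.coeff 0 : ℝ) : ℂ)), fun Φ hΦ => ?_⟩
        have hp1 : p = C (p.coeff 1) * X + C (p.coeff 0) := eq_X_add_C_of_natDegree_le_one hp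
        have key : ∀ n : ℤ, Complex.exp (2 * Real.pi * Complex.I * ((p.eval (n : ℝ) : ℝ) : ℂ)) =
            Complex.exp (2 * Real.pi * Complex.I * ((p.coeff 0 : ℝ) : ℂ)) := by
          intro n
          rw [← e_add_int (p.coeff 0) (n * m)]
          congr 3
          conv_lhs => rw [hp1]
          simp only [eval_add, eval_mul, eval_C, eval_X, hm]
          push_cast
          ring
        simp_rw [key]
        exact hΦ.tendsto_avg_const _
      · push Not at hint
        exact ⟨0, fun Φ hΦ => hΦ.tendsto_avg_e_deg_one hp hint⟩
    · -- degree ≤ d + 2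
      by_cases hirr : Irrational (p.coeff (d + 1 + 1))
      · exact ⟨0, fun Φ hΦ => hΦ.tendsto_avg_e_poly_of_irrational (d + 1) p hp hirr⟩
      · -- rational top coefficient `α = m / q`
        obtain ⟨ρ, hρ⟩ : ∃ ρ : ℚ, (ρ : ℝ) = p.coeff (d + 1 + 1) := by
          unfold Irrational at hirr
          push Not at hirr
          exact hirr
        set α : ℝ := p.coeff (d + 1 + 1) with hα
        set m : ℤ := ρ.num with hm
        set q : ℕ := ρ.den with hqdef
        have hq : 0 < q := ρ.den_pos
        have hαmq : α = (m / q : ℝ) := by rw [← hρ, Rat.cast_def]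
        set p' : ℝ[X] := p - C α * X ^ (d + 1 + 1) with hp'
        have hp'deg : p'.natDegree ≤ d + 1 := natDegree_sub_C_mul_X_pow_le hp
        have hps : ∀ s : ℕ, (p' + C ((s : ℝ) / q) * X).natDegree ≤ d + 1 := by
          intro s
          refine (natDegree_add_le _ _).trans (max_le hp'deg ?_)
          refine (natDegree_C_mul_le _ _).trans ?_
          simp
        have hlim : ∀ s : ℕ, ∃ c : ℂ, ∀ Φ : ℕ → Finset ℤ, IsFoelnerSeq Φ →
            Tendsto (fun N => ((Φ N).card : ℂ)⁻¹ * ∑ n ∈ Φ N, Complex.exp (2 * Real.pi *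
              Complex.I * (((p' + C ((s : ℝ) / q) * X).eval (n : ℝ) : ℝ) : ℂ))) atTop (𝓝 c) :=
          fun s => ih _ (hps s)
        choose cs hcs using hlim
        set F : ℤ → ℂ := fun n => Complex.exp (2 * Real.pi * Complex.I *
          (((m / q : ℝ) * (n : ℝ) ^ (d + 1 + 1) : ℝ) : ℂ)) with hF
        have hFper : Function.Periodic F (q : ℤ) := periodic_e_rat_mul_pow m hq (d + 1 + 1)
        set coef : ℕ → ℂ := fun s => (q : ℂ)⁻¹ * ∑ r ∈ range q,
          F r * Complex.exp (2 * Real.pi * Complex.I * ((-((s : ℝ) * r / q) : ℝ) : ℂ)) with hcoef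
        have hdecomp : ∀ n : ℤ, Complex.exp (2 * Real.pi * Complex.I * ((p.eval (n : ℝ) : ℝ) : ℂ)) =
            ∑ s ∈ range q, coef s * Complex.exp (2 * Real.pi * Complex.I *
              (((p' + C ((s : ℝ) / q) * X).eval (n : ℝ) : ℝ) : ℂ)) := by
          intro n
          have h1 : p.eval (n : ℝ) = (m / q : ℝ) * (n : ℝ) ^ (d + 1 + 1) + p'.eval (n : ℝ) := by
            rw [hp', eval_sub, eval_mul, eval_C, eval_pow, eval_X, ← hαmq]
            ring
          rw [h1, e_add]
          have h2 := periodic_expansion hq hFper n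
          simp only [hF] at h2 ⊢
          rw [h2, Finset.sum_mul]
          refine Finset.sum_congr rfl fun s _ => ?_
          rw [mul_assoc, ← e_add]
          congr 3
          simp only [eval_add, eval_mul, eval_C, eval_X]
          ring
        refine ⟨∑ s ∈ range q, coef s * cs s, fun Φ hΦ => ?_⟩
        have havg : ∀ N : ℕ, ((Φ N).card : ℂ)⁻¹ *
            ∑ n ∈ Φ N, Complex.exp (2 * Real.pi * Complex.I * ((p.eval (n : ℝ) : ℝ) : ℂ)) =
            ∑ s ∈ range q, coef s * (((Φ N).card : ℂ)⁻¹ * ∑ n ∈ Φ N, Complex.exp (2 * Real.pi *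
              Complex.I * (((p' + C ((s : ℝ) / q) * X).eval (n : ℝ) : ℝ) : ℂ))) := by
          intro N
          simp_rw [hdecomp]
          rw [Finset.sum_comm, Finset.mul_sum]
          refine Finset.sum_congr rfl fun s _ => ?_
          rw [← Finset.mul_sum]
          ring
        simp_rw [havg]
        exact tendsto_finsetSum _ fun s _ => (hcs s Φ hΦ).const_mul _

/-- **Weyl's theorem along Følner sequences of `ℤ`** (existence and Følner-independence of the
limit): for every real polynomial `p` there is ONE `c ∈ ℂ` with
`|Φ_N|⁻¹ Σ_{n ∈ Φ_N} e^{2πi p(n)} → c` along EVERY Følner sequence `Φ`.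
[cite: Weyl1916, Satz 9] -/
theorem weyl_foelner_limit (p : ℝ[X]) :
    ∃ c : ℂ, ∀ Φ : ℕ → Finset ℤ, IsFoelnerSeq Φ →
      Tendsto (fun N => ((Φ N).card : ℂ)⁻¹ *
        ∑ n ∈ Φ N, Complex.exp (2 * Real.pi * Complex.I * ((p.eval (n : ℝ) : ℝ) : ℂ)))
        atTop (𝓝 c) :=
  exists_tendsto_avg_e_poly p.natDegree p le_rfl

/-! ### Bergelson–Leibman 2007, Cor. 0.26: the polynomial layer and the reduction to bounded GP -/

/-- **The polynomial case of `BergelsonLeibman2007_cor_0_26`** (generalized polynomials of the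
form `u(n) = p(n)`, constructor `IsGeneralizedPolynomial.poly`): the limit of
`|Φ_N|⁻¹ Σ_{n ∈ Φ_N} e^{2πi p(n)}` exists and is the same for all Følner sequences — Weyl's
theorem, the abelian layer of the Bergelson–Leibman theorem.
[cite: BergelsonLeibman2007, Cor. 0.26 (case of §0.4)] -/
theorem bergelsonLeibman2007_cor_0_26_poly (p : ℝ[X]) :
    ∃ c : ℂ, ∀ Φ : ℕ → Finset ℤ, IsFoelnerSeq Φ →
      Tendsto (fun N => ((Φ N).card : ℂ)⁻¹ *
        ∑ n ∈ Φ N, Complex.exp (2 * Real.pi * Complex.I *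
          ((fun n : ℤ => p.eval (n : ℝ)) n : ℂ))) atTop (nhds c) :=
  weyl_foelner_limit p

/-- **The printed reduction in Cor. 0.26**: "the generalized polynomial `u` is not assumed to be
bounded, but this does not matter in view of the identity `e^{2πiu(n)} = e^{2πi{u(n)}}`" — it
suffices to treat generalized polynomials with values in `[0, 1)` (to which Cor. 0.25 /
Theorem B apply). [cite: BergelsonLeibman2007, Cor. 0.26] -/
theorem BergelsonLeibman2007_cor_0_26_of_bounded
    (h : ∀ u : ℤ → ℝ, IsGeneralizedPolynomial u → (∀ n, u n ∈ Set.Ico (0 : ℝ) 1) →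
      ∃ c : ℂ, ∀ Φ : ℕ → Finset ℤ, IsFoelnerSeq Φ →
        Tendsto (fun N => ((Φ N).card : ℂ)⁻¹ *
          ∑ n ∈ Φ N, Complex.exp (2 * Real.pi * Complex.I * (u n : ℂ))) atTop (nhds c)) :
    BergelsonLeibman2007_cor_0_26 := by
  intro u hu
  obtain ⟨c, hc⟩ := h (fun n => Int.fract (u n)) hu.fract
    (fun n => ⟨Int.fract_nonneg _, Int.fract_lt_one _⟩)
  refine ⟨c, fun Φ hΦ => ?_⟩
  have key : ∀ n : ℤ, Complex.exp (2 * Real.pi * Complex.I * (u n : ℂ)) =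
      Complex.exp (2 * Real.pi * Complex.I * ((Int.fract (u n) : ℝ) : ℂ)) := by
    intro n
    rw [← e_add_int (Int.fract (u n)) ⌊u n⌋, Int.fract_add_floor]
  simp_rw [key]
  exact hc Φ hΦ


/-! ### Joint distribution: continuous functions of polynomial orbits on a torus

Bergelson–Leibman §0.7 (citing Weyl 1916, Thm 18): for a polynomial mapping
`P = (P_i)_{i ∈ ι} : ℤ → ℝ^ι` the sequence `P(n) mod 1` in the torus `𝕋^ι` has a limit
distribution; here in the form needed later — for every CONTINUOUS `G : 𝕋^ι → ℂ` the averages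
`|Φ_N|⁻¹ Σ_{n ∈ Φ_N} G(P(n) mod 1)` converge, to a limit independent of the Følner sequence.
Proof: characters `mFourier m` reduce to `weyl_foelner_limit` for `Σ mᵢ Pᵢ`; the set of `G` with
the property is a closed subspace of `C(𝕋^ι, ℂ)`; trigonometric polynomials are dense
(`UnitAddTorus.span_mFourier_closure_eq_top`). -/

section Torus

open UnitAddTorus

/-- The initial segments `{0, …, N-1}` form a Følner sequence of `ℤ`.
[cite: BergelsonLeibman2007, §0.21] -/
theorem isFoelnerSeq_Ico : IsFoelnerSeq fun N => Finset.Ico (0 : ℤ) N := by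
  refine ⟨?_, ?_⟩
  · filter_upwards [eventually_ge_atTop 1] with N hN
    exact ⟨0, Finset.mem_Ico.2 ⟨le_rfl, by exact_mod_cast hN⟩⟩
  · have hcard : ∀ N : ℕ, ((Finset.Ico (0 : ℤ) N) ∆
        ((Finset.Ico (0 : ℤ) N).image fun n => n + 1)).card ≤ 2 := by
      intro N
      have hsub : (Finset.Ico (0 : ℤ) N) ∆ ((Finset.Ico (0 : ℤ) N).image fun n => n + 1) ⊆
          {(0 : ℤ), (N : ℤ)} := by
        intro x hx
        simp only [Finset.mem_symmDiff, Finset.mem_Ico, Finset.mem_image, Finset.mem_insert,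
          Finset.mem_singleton] at hx ⊢
        rcases hx with ⟨⟨h0, hN⟩, hnot⟩ | ⟨⟨a, ⟨ha0, haN⟩, rfl⟩, hnot⟩
        · push Not at hnot
          have := hnot (x - 1)
          omega
        · omega
      exact (Finset.card_le_card hsub).trans (Finset.card_le_two)
    have hN : ∀ N : ℕ, ((Finset.Ico (0 : ℤ) N).card : ℝ) = N := by
      intro N
      rw [Int.card_Ico]
      simp
    refine squeeze_zero (fun N => by positivity) (fun N => ?_)
      (tendsto_const_div_atTop_nhds_zero_nat (2 : ℝ))
    rw [hN]
    rcases Nat.eq_zero_or_pos N with h | h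
    · subst h; simp
    · gcongr
      exact_mod_cast hcard N

/-- Averages of a `B`-bounded function have norm `≤ B`. [folklore] -/
theorem FoelnerWeyl.norm_avg_le {A : Finset ℤ} {f : ℤ → ℂ} {B : ℝ} (hB : 0 ≤ B)
    (hf : ∀ n, ‖f n‖ ≤ B) : ‖((A.card : ℂ))⁻¹ * ∑ n ∈ A, f n‖ ≤ B := by
  rw [FoelnerWeyl.norm_avg_eq]
  rcases A.eq_empty_or_nonempty with h | h
  · subst h; simpa using hB
  · rw [div_le_iff₀ (by exact_mod_cast h.card_pos)]
    calc ‖∑ n ∈ A, f n‖ ≤ ∑ n ∈ A, ‖f n‖ := norm_sum_le _ _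
      _ ≤ ∑ _n ∈ A, B := Finset.sum_le_sum fun n _ => hf n
      _ = B * A.card := by rw [Finset.sum_const, nsmul_eq_mul, mul_comm]

/-- A character of the torus along a polynomial orbit is the phase of ONE polynomial:
`mFourier m (P(n) mod 1) = e((Σᵢ mᵢ Pᵢ)(n))`. [folklore] -/
theorem mFourier_apply_polyOrbit {ι : Type*} [Fintype ι] (P : ι → ℝ[X]) (m : ι → ℤ) (n : ℤ) :
    mFourier m (fun i => ((((P i).eval (n : ℝ) : ℝ)) : UnitAddCircle)) =
      Complex.exp (2 * Real.pi * Complex.I *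
        (((∑ i, C ((m i : ℝ)) * P i).eval (n : ℝ) : ℝ) : ℂ)) := by
  simp only [mFourier, ContinuousMap.coe_mk, fourier_coe_apply]
  rw [← Complex.exp_sum, eval_finsetSum]
  congr 1
  push_cast
  rw [Finset.mul_sum]
  refine Finset.sum_congr rfl fun i _ => ?_
  simp only [eval_mul, eval_C]
  push_cast
  ring

/-- **Existence and Følner-independence of the limit distribution of a polynomial orbit on a
torus, tested against continuous functions** (Bergelson–Leibman §0.7, after Weyl 1916): for
`P : ι → ℝ[X]` and every `G ∈ C(𝕋^ι, ℂ)` there is `c` with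
`|Φ_N|⁻¹ Σ_{n ∈ Φ_N} G((Pᵢ(n) mod 1)ᵢ) → c` along every Følner sequence `Φ` of `ℤ`.
[cite: BergelsonLeibman2007, §0.7] -/
theorem weyl_foelner_limit_torus {ι : Type*} [Fintype ι] (P : ι → ℝ[X])
    (G : C(UnitAddTorus ι, ℂ)) :
    ∃ c : ℂ, ∀ Φ : ℕ → Finset ℤ, IsFoelnerSeq Φ →
      Tendsto (fun N => ((Φ N).card : ℂ)⁻¹ *
        ∑ n ∈ Φ N, G (fun i => ((((P i).eval (n : ℝ) : ℝ)) : UnitAddCircle))) atTop (𝓝 c) := by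
  classical
  -- the subspace of test functions with Følner-independent limits
  let S : Submodule ℂ C(UnitAddTorus ι, ℂ) :=
    { carrier := {G | ∃ c : ℂ, ∀ Φ : ℕ → Finset ℤ, IsFoelnerSeq Φ →
        Tendsto (fun N => ((Φ N).card : ℂ)⁻¹ *
          ∑ n ∈ Φ N, G (fun i => ((((P i).eval (n : ℝ) : ℝ)) : UnitAddCircle))) atTop (𝓝 c)}
      add_mem' := by
        rintro G₁ G₂ ⟨c₁, h₁⟩ ⟨c₂, h₂⟩
        refine ⟨c₁ + c₂, fun Φ hΦ => ?_⟩
        have := (h₁ Φ hΦ).add (h₂ Φ hΦ)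
        refine this.congr' (Eventually.of_forall fun N => ?_)
        simp only [ContinuousMap.add_apply, Finset.sum_add_distrib, mul_add]
      zero_mem' := ⟨0, fun Φ hΦ => by simp⟩
      smul_mem' := by
        rintro a G ⟨c, h⟩
        refine ⟨a * c, fun Φ hΦ => ?_⟩
        have := (h Φ hΦ).const_mul a
        refine this.congr' (Eventually.of_forall fun N => ?_)
        simp only [ContinuousMap.smul_apply, smul_eq_mul, Finset.mul_sum]
        exact Finset.sum_congr rfl fun n _ => by ring }
  -- characters belong to `S`
  have hchar : ∀ m : ι → ℤ, mFourier m ∈ S := by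
    intro m
    obtain ⟨c, hc⟩ := weyl_foelner_limit (∑ i, C ((m i : ℝ)) * P i)
    refine ⟨c, fun Φ hΦ => ?_⟩
    simp_rw [mFourier_apply_polyOrbit]
    exact hc Φ hΦ
  -- `S` is closed
  have hclosed : IsClosed (S : Set C(UnitAddTorus ι, ℂ)) := by
    refine IsSeqClosed.isClosed fun Gk G hGk hG => ?_
    choose ck hck using hGk
    -- the limits `ck` form a Cauchy sequence: `‖ck k - ck j‖ ≤ ‖Gk k - Gk j‖`
    have hdist : ∀ k j, ‖ck k - ck j‖ ≤ ‖Gk k - Gk j‖ := by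
      intro k j
      have hlim := ((hck k _ isFoelnerSeq_Ico).sub (hck j _ isFoelnerSeq_Ico)).norm
      refine le_of_tendsto' hlim fun N => ?_
      rw [← mul_sub, ← Finset.sum_sub_distrib]
      exact FoelnerWeyl.norm_avg_le (norm_nonneg _) fun n => by
        simpa using (Gk k - Gk j).norm_coe_le_norm _
    have hcauchy : CauchySeq ck := by
      rw [Metric.cauchySeq_iff]
      intro ε hε
      obtain ⟨K, hK⟩ := Metric.cauchySeq_iff.1 hG.cauchySeq ε hε
      refine ⟨K, fun k hk j hj => ?_⟩
      calc dist (ck k) (ck j) = ‖ck k - ck j‖ := dist_eq_norm _ _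
        _ ≤ ‖Gk k - Gk j‖ := hdist k j
        _ = dist (Gk k) (Gk j) := (dist_eq_norm _ _).symm
        _ < ε := hK k hk j hj
    obtain ⟨c, hc⟩ := cauchySeq_tendsto_of_complete hcauchy
    refine ⟨c, fun Φ hΦ => ?_⟩
    rw [Metric.tendsto_atTop]
    intro ε hε
    have hε3 : 0 < ε / 3 := by positivity
    have h1 : ∀ᶠ k in atTop, dist (Gk k) G < ε / 3 := Metric.tendsto_nhds.1 hG _ hε3
    have h2 : ∀ᶠ k in atTop, dist (ck k) c < ε / 3 := Metric.tendsto_nhds.1 hc _ hε3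
    obtain ⟨k, hk1, hk2⟩ := (h1.and h2).exists
    obtain ⟨N₀, hN₀⟩ := Metric.tendsto_atTop.1 (hck k Φ hΦ) _ hε3
    refine ⟨N₀, fun N hN => ?_⟩
    have hA : ‖((Φ N).card : ℂ)⁻¹ *
          ∑ n ∈ Φ N, G (fun i => ((((P i).eval (n : ℝ) : ℝ)) : UnitAddCircle)) -
        ((Φ N).card : ℂ)⁻¹ *
          ∑ n ∈ Φ N, Gk k (fun i => ((((P i).eval (n : ℝ) : ℝ)) : UnitAddCircle))‖ ≤ ε / 3 := by
      rw [← mul_sub, ← Finset.sum_sub_distrib]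
      refine FoelnerWeyl.norm_avg_le hε3.le fun n => ?_
      have := (G - Gk k).norm_coe_le_norm (fun i => ((((P i).eval (n : ℝ) : ℝ)) : UnitAddCircle))
      simp only [ContinuousMap.sub_apply] at this
      refine this.trans ?_
      rw [← dist_eq_norm, dist_comm]
      exact hk1.le
    calc dist (((Φ N).card : ℂ)⁻¹ *
            ∑ n ∈ Φ N, G (fun i => ((((P i).eval (n : ℝ) : ℝ)) : UnitAddCircle))) c
        ≤ ‖((Φ N).card : ℂ)⁻¹ *
              ∑ n ∈ Φ N, G (fun i => ((((P i).eval (n : ℝ) : ℝ)) : UnitAddCircle)) -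
            ((Φ N).card : ℂ)⁻¹ *
              ∑ n ∈ Φ N, Gk k (fun i => ((((P i).eval (n : ℝ) : ℝ)) : UnitAddCircle))‖ +
          dist (((Φ N).card : ℂ)⁻¹ *
              ∑ n ∈ Φ N, Gk k (fun i => ((((P i).eval (n : ℝ) : ℝ)) : UnitAddCircle))) (ck k) +
          dist (ck k) c := by
            rw [← dist_eq_norm]
            exact dist_triangle4 _ _ _ _
      _ < ε / 3 + ε / 3 + ε / 3 := by linarith [hA, hN₀ N hN, hk2]
      _ = ε := by ring
  -- density
  have htop : (⊤ : Submodule ℂ C(UnitAddTorus ι, ℂ)) ≤ S := by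
    rw [← span_mFourier_closure_eq_top]
    exact Submodule.topologicalClosure_minimal _ (Submodule.span_le.2 (by
      rintro _ ⟨m, rfl⟩
      exact hchar m)) hclosed
  exact htop (Submodule.mem_top : G ∈ ⊤)

end Torus


/-! ### From continuous to Riemann-integrable test functions: the sandwich principle

The step of Bergelson–Leibman's Theorem 4.2 (= Cor. 0.25) that passes from well-distribution to
Riemann-integrable functions, in a measure-free form: a real sequence squeezed, for every `ε`,
between two sequences having Følner-independent limits at distance `< ε` has itself a
Følner-independent limit. -/

section Sandwich

/-- Real Følner averages are monotone in the sequence. [folklore] -/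
theorem FoelnerWeyl.avg_le_avg {A : Finset ℤ} {g h : ℤ → ℝ} (hgh : ∀ n, g n ≤ h n) :
    ((A.card : ℝ))⁻¹ * ∑ n ∈ A, g n ≤ ((A.card : ℝ))⁻¹ * ∑ n ∈ A, h n :=
  mul_le_mul_of_nonneg_left (Finset.sum_le_sum fun n _ => hgh n) (by positivity)

/-- **Sandwich principle for Følner limits** (the Riemann-integrability step of
Bergelson–Leibman's Theorem 4.2, measure-free): if for every `ε > 0` the real sequence `f` is
squeezed `g ≤ f ≤ h` between sequences with Følner-independent limits `c_g ≤ c_h < c_g + ε`, then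
`f` has a Følner-independent limit. [cite: BergelsonLeibman2007, Thm 4.2 (proof)] -/
theorem foelner_limit_of_sandwich (f : ℤ → ℝ)
    (hf : ∀ ε : ℝ, 0 < ε → ∃ g h : ℤ → ℝ, (∀ n, g n ≤ f n) ∧ (∀ n, f n ≤ h n) ∧
      ∃ cg ch : ℝ,
        (∀ Φ : ℕ → Finset ℤ, IsFoelnerSeq Φ →
          Tendsto (fun N => ((Φ N).card : ℝ)⁻¹ * ∑ n ∈ Φ N, g n) atTop (𝓝 cg)) ∧
        (∀ Φ : ℕ → Finset ℤ, IsFoelnerSeq Φ →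
          Tendsto (fun N => ((Φ N).card : ℝ)⁻¹ * ∑ n ∈ Φ N, h n) atTop (𝓝 ch)) ∧
        ch < cg + ε) :
    ∃ c : ℝ, ∀ Φ : ℕ → Finset ℤ, IsFoelnerSeq Φ →
      Tendsto (fun N => ((Φ N).card : ℝ)⁻¹ * ∑ n ∈ Φ N, f n) atTop (𝓝 c) := by
  choose g h hgf hfh cg ch hcg hch hgap using
    fun k : ℕ => hf (1 / ((k : ℝ) + 1)) (by positivity)
  -- lower limits are below upper limits
  have hle : ∀ k j, cg k ≤ ch j := by
    intro k j
    refine le_of_tendsto_of_tendsto' (hcg k _ isFoelnerSeq_Ico) (hch j _ isFoelnerSeq_Ico)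
      fun N => ?_
    exact FoelnerWeyl.avg_le_avg fun n => (hgf k n).trans (hfh j n)
  have hbdd : BddAbove (Set.range cg) := ⟨ch 0, by rintro _ ⟨k, rfl⟩; exact hle k 0⟩
  set c : ℝ := sSup (Set.range cg) with hc
  have hcg_le : ∀ k, cg k ≤ c := fun k => le_csSup hbdd ⟨k, rfl⟩
  have hc_le : ∀ j, c ≤ ch j := fun j => csSup_le ⟨cg 0, ⟨0, rfl⟩⟩ (by
    rintro _ ⟨k, rfl⟩; exact hle k j)
  refine ⟨c, fun Φ hΦ => ?_⟩
  rw [Metric.tendsto_atTop]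
  intro ε hε
  obtain ⟨k, hk⟩ := exists_nat_gt (2 / ε)
  have hk' : 1 / ((k : ℝ) + 1) < ε / 2 := by
    rw [div_lt_iff₀ (by positivity)]
    rw [div_lt_iff₀ hε] at hk
    nlinarith
  have h1 : ∀ᶠ N in atTop, dist (((Φ N).card : ℝ)⁻¹ * ∑ n ∈ Φ N, g k n) (cg k) < ε / 2 :=
    Metric.tendsto_nhds.1 (hcg k Φ hΦ) _ (by positivity)
  have h2 : ∀ᶠ N in atTop, dist (((Φ N).card : ℝ)⁻¹ * ∑ n ∈ Φ N, h k n) (ch k) < ε / 2 :=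
    Metric.tendsto_nhds.1 (hch k Φ hΦ) _ (by positivity)
  obtain ⟨N₀, hN₀⟩ := eventually_atTop.1 (h1.and h2)
  refine ⟨N₀, fun N hN => ?_⟩
  obtain ⟨hN1, hN2⟩ := hN₀ N hN
  rw [Real.dist_eq, abs_sub_lt_iff] at hN1 hN2 ⊢
  have hlo := FoelnerWeyl.avg_le_avg (A := Φ N) (hgf k)
  have hhi := FoelnerWeyl.avg_le_avg (A := Φ N) (hfh k)
  have := hgap k
  have := hcg_le k
  have := hc_le k
  constructor <;> linarith

/-- A complex sequence has a Følner-independent limit as soon as its real and imaginary parts do.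
[folklore] -/
theorem foelner_limit_of_re_im (f : ℤ → ℂ) {a b : ℝ}
    (ha : ∀ Φ : ℕ → Finset ℤ, IsFoelnerSeq Φ →
      Tendsto (fun N => ((Φ N).card : ℝ)⁻¹ * ∑ n ∈ Φ N, (f n).re) atTop (𝓝 a))
    (hb : ∀ Φ : ℕ → Finset ℤ, IsFoelnerSeq Φ →
      Tendsto (fun N => ((Φ N).card : ℝ)⁻¹ * ∑ n ∈ Φ N, (f n).im) atTop (𝓝 b)) :
    ∀ Φ : ℕ → Finset ℤ, IsFoelnerSeq Φ →
      Tendsto (fun N => ((Φ N).card : ℂ)⁻¹ * ∑ n ∈ Φ N, f n) atTop (𝓝 (a + b * Complex.I)) := by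
  intro Φ hΦ
  have h := ((Complex.continuous_ofReal.tendsto a).comp (ha Φ hΦ)).add
    (((Complex.continuous_ofReal.tendsto b).comp (hb Φ hΦ)).mul_const Complex.I)
  refine h.congr fun N => ?_
  simp only [Function.comp_def]
  rw [Complex.ext_iff]
  simp [Complex.re_sum, Complex.im_sum, Finset.mul_sum]

end Sandwich

/-! ### Periodic sequences -/

section PeriodicLimit

/-- **Periodic sequences have Følner-independent averages**: if `F : ℤ → ℂ` is `q`-periodic then
`|Φ_N|⁻¹ Σ_{n ∈ Φ_N} F(n) → q⁻¹ Σ_{r<q} F(r)` along every Følner sequence (finite Fourier expansion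
`FoelnerWeyl.periodic_expansion` and the degree-one case). [folklore] -/
theorem IsFoelnerSeq.tendsto_avg_of_periodic {Φ : ℕ → Finset ℤ} (hΦ : IsFoelnerSeq Φ) {q : ℕ}
    (hq : 0 < q) {F : ℤ → ℂ} (hF : Function.Periodic F (q : ℤ)) :
    Tendsto (fun N => ((Φ N).card : ℂ)⁻¹ * ∑ n ∈ Φ N, F n) atTop
      (𝓝 ((q : ℂ)⁻¹ * ∑ r ∈ range q, F r)) := by
  -- Fourier coefficients and the limits of the characters `e(sn/q)`
  set coef : ℕ → ℂ := fun s => (q : ℂ)⁻¹ * ∑ r ∈ range q,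
    F r * Complex.exp (2 * Real.pi * Complex.I * ((-((s : ℝ) * r / q) : ℝ) : ℂ)) with hcoef
  have hchar : ∀ s ∈ range q, Tendsto (fun N => ((Φ N).card : ℂ)⁻¹ *
      ∑ n ∈ Φ N, Complex.exp (2 * Real.pi * Complex.I * (((s : ℝ) * n / q : ℝ) : ℂ))) atTop
      (𝓝 (if s = 0 then 1 else 0)) := by
    intro s hs
    split_ifs with h0
    · subst h0
      simp only [CharP.cast_eq_zero, zero_mul, zero_div, Complex.ofReal_zero, mul_zero,
        Complex.exp_zero]
      exact hΦ.tendsto_avg_const 1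
    · have hθ : ∀ m : ℤ, (s : ℝ) / q ≠ m := by
        intro m hm
        have hsq : (s : ℝ) < q := by exact_mod_cast Finset.mem_range.1 hs
        have hqpos : (0 : ℝ) < q := by exact_mod_cast hq
        have h01 : 0 < (s : ℝ) / q ∧ (s : ℝ) / q < 1 :=
          ⟨by positivity, (div_lt_one hqpos).2 hsq⟩
        rw [hm] at h01
        have h1 : (0 : ℤ) < m := by exact_mod_cast h01.1
        have h2 : m < (1 : ℤ) := by exact_mod_cast h01.2
        omega
      have := hΦ.tendsto_avg_e_linear hθ
      refine this.congr fun N => ?_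
      congr 1
      refine Finset.sum_congr rfl fun n _ => ?_
      congr 2
      push_cast
      ring
  have hlim : Tendsto (fun N => ∑ s ∈ range q, coef s * (((Φ N).card : ℂ)⁻¹ *
      ∑ n ∈ Φ N, Complex.exp (2 * Real.pi * Complex.I * (((s : ℝ) * n / q : ℝ) : ℂ)))) atTop
      (𝓝 (∑ s ∈ range q, coef s * (if s = 0 then 1 else 0))) :=
    tendsto_finsetSum _ fun s hs => (hchar s hs).const_mul _
  have hval : ∑ s ∈ range q, coef s * (if s = 0 then (1 : ℂ) else 0) =
      (q : ℂ)⁻¹ * ∑ r ∈ range q, F r := by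
    simp only [mul_ite, mul_one, mul_zero, Finset.sum_ite_eq', Finset.mem_range, hq, if_true]
    simp [hcoef]
  rw [← hval]
  refine hlim.congr fun N => ?_
  have hexp : ∀ n : ℤ, F n = ∑ s ∈ range q, coef s *
      Complex.exp (2 * Real.pi * Complex.I * (((s : ℝ) * n / q : ℝ) : ℂ)) :=
    fun n => FoelnerWeyl.periodic_expansion hq hF n
  symm
  calc ((Φ N).card : ℂ)⁻¹ * ∑ n ∈ Φ N, F n
      = ((Φ N).card : ℂ)⁻¹ * ∑ n ∈ Φ N, ∑ s ∈ range q, coef s *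
          Complex.exp (2 * Real.pi * Complex.I * (((s : ℝ) * n / q : ℝ) : ℂ)) := by
        congr 1
        exact Finset.sum_congr rfl fun n _ => hexp n
    _ = ∑ s ∈ range q, ((Φ N).card : ℂ)⁻¹ * ∑ n ∈ Φ N, coef s *
          Complex.exp (2 * Real.pi * Complex.I * (((s : ℝ) * n / q : ℝ) : ℂ)) := by
        rw [Finset.sum_comm, Finset.mul_sum]
    _ = ∑ s ∈ range q, coef s * (((Φ N).card : ℂ)⁻¹ *
          ∑ n ∈ Φ N, Complex.exp (2 * Real.pi * Complex.I * (((s : ℝ) * n / q : ℝ) : ℂ))) := by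
        refine Finset.sum_congr rfl fun s _ => ?_
        rw [← Finset.mul_sum]
        ring

end PeriodicLimit


/-! ### The value of the limit: Weyl's Satz 9 in full and Satz 14 (equidistribution in `𝕋^ι`)

Weyl 1916, Satz 9 (p. 326) in full generality — the averages of `e(p(n))` vanish as soon as SOME
coefficient of positive degree is irrational — and Satz 14 (p. 334): if no non-trivial integer
combination `Σ mᵢ Pᵢ` of the polynomials `Pᵢ` is congruent mod 1 to a constant, the points
`(Pᵢ(n))ᵢ mod 1` are equidistributed in the unit cube; here along Følner sequences and tested
against continuous functions (the limit in `weyl_foelner_limit_torus` is the Haar integral). -/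

section WeylValue

open UnitAddTorus MeasureTheory

/-- The finite-Fourier decomposition of the averages of `e(p(n))` when the top coefficient
`[X^{d+2}] p = ρ` is rational (denominator `q`): `avg e(p) = Σ_{s<q} ĉ_s · avg e(p_s)` with
`p_s = (p - ρ X^{d+2}) + (s/q) X` (no degree hypothesis is needed for the identity). [folklore] -/
theorem FoelnerWeyl.avg_e_poly_decomp_of_rat {p : ℝ[X]} {d : ℕ}
    {ρ : ℚ} (hρ : (ρ : ℝ) = p.coeff (d + 1 + 1)) :
    ∃ coef : ℕ → ℂ, ∀ A : Finset ℤ,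
      ((A.card : ℂ))⁻¹ * ∑ n ∈ A, Complex.exp (2 * Real.pi * Complex.I * ((p.eval (n : ℝ) : ℝ) : ℂ)) =
        ∑ s ∈ range ρ.den, coef s * (((A.card : ℂ))⁻¹ * ∑ n ∈ A, Complex.exp (2 * Real.pi *
          Complex.I * ((((p - C (p.coeff (d + 1 + 1)) * X ^ (d + 1 + 1)) +
            C ((s : ℝ) / ρ.den) * X).eval (n : ℝ) : ℝ) : ℂ))) := by
  set α : ℝ := p.coeff (d + 1 + 1) with hα
  set m : ℤ := ρ.num with hm
  set q : ℕ := ρ.den with hqdef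
  have hq : 0 < q := ρ.den_pos
  have hαmq : α = (m / q : ℝ) := by rw [← hρ, Rat.cast_def]
  set p' : ℝ[X] := p - C α * X ^ (d + 1 + 1) with hp'
  set F : ℤ → ℂ := fun n => Complex.exp (2 * Real.pi * Complex.I *
    (((m / q : ℝ) * (n : ℝ) ^ (d + 1 + 1) : ℝ) : ℂ)) with hF
  have hFper : Function.Periodic F (q : ℤ) := periodic_e_rat_mul_pow m hq (d + 1 + 1)
  set coef : ℕ → ℂ := fun s => (q : ℂ)⁻¹ * ∑ r ∈ range q,
    F r * Complex.exp (2 * Real.pi * Complex.I * ((-((s : ℝ) * r / q) : ℝ) : ℂ)) with hcoef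
  have hdecomp : ∀ n : ℤ, Complex.exp (2 * Real.pi * Complex.I * ((p.eval (n : ℝ) : ℝ) : ℂ)) =
      ∑ s ∈ range q, coef s * Complex.exp (2 * Real.pi * Complex.I *
        (((p' + C ((s : ℝ) / q) * X).eval (n : ℝ) : ℝ) : ℂ)) := by
    intro n
    have h1 : p.eval (n : ℝ) = (m / q : ℝ) * (n : ℝ) ^ (d + 1 + 1) + p'.eval (n : ℝ) := by
      rw [hp', eval_sub, eval_mul, eval_C, eval_pow, eval_X, ← hαmq]
      ring
    rw [h1, e_add]
    have h2 := periodic_expansion hq hFper n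
    simp only [hF] at h2 ⊢
    rw [h2, Finset.sum_mul]
    refine Finset.sum_congr rfl fun s _ => ?_
    rw [mul_assoc, ← e_add]
    congr 3
    simp only [eval_add, eval_mul, eval_C, eval_X]
    ring
  refine ⟨coef, fun A => ?_⟩
  simp_rw [hdecomp]
  rw [Finset.sum_comm, Finset.mul_sum]
  refine Finset.sum_congr rfl fun s _ => ?_
  rw [← Finset.mul_sum]
  ring

/-- **Weyl 1916, Satz 9, in full, along Følner sequences**: if SOME coefficient of positive degree
of the real polynomial `p` is irrational, then `|Φ_N|⁻¹ Σ_{n ∈ Φ_N} e(p(n)) → 0` for every Følner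
sequence `Φ` of `ℤ` (the leading-coefficient case `tendsto_avg_e_poly_of_irrational` plus the
finite-Fourier reduction of a rational top coefficient, by induction on the degree).
[cite: Weyl1916, Satz 9] -/
theorem IsFoelnerSeq.tendsto_avg_e_poly_zero {Φ : ℕ → Finset ℤ} (hΦ : IsFoelnerSeq Φ) (d : ℕ) :
    ∀ p : ℝ[X], p.natDegree ≤ d → (∃ j, 1 ≤ j ∧ Irrational (p.coeff j)) →
      Tendsto (fun N => ((Φ N).card : ℂ)⁻¹ *
        ∑ n ∈ Φ N, Complex.exp (2 * Real.pi * Complex.I * ((p.eval (n : ℝ) : ℝ) : ℂ)))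
        atTop (𝓝 0) := by
  induction d with
  | zero =>
    rintro p hp ⟨j, hj, hirr⟩
    rw [coeff_eq_zero_of_natDegree_lt (by omega)] at hirr
    exact (hirr ⟨0, by simp⟩).elim
  | succ d ih =>
    rintro p hp ⟨j, hj, hirr⟩
    by_cases htop : Irrational (p.coeff (d + 1))
    · exact hΦ.tendsto_avg_e_poly_of_irrational d p hp htop
    · have hjd : j ≠ d + 1 := fun h => htop (h ▸ hirr)
      have hjn : j ≤ p.natDegree := by
        by_contra h
        push Not at h
        rw [coeff_eq_zero_of_natDegree_lt h] at hirr
        exact hirr ⟨0, by simp⟩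
      have hjle : j ≤ d := by omega
      obtain ⟨ρ, hρ⟩ : ∃ ρ : ℚ, (ρ : ℝ) = p.coeff (d + 1) := by
        unfold Irrational at htop
        push Not at htop
        exact htop
      rcases d with _ | d
      · omega
      · obtain ⟨coef, hcoef⟩ := FoelnerWeyl.avg_e_poly_decomp_of_rat hρ
        simp_rw [hcoef]
        rw [show (0 : ℂ) = ∑ s ∈ range ρ.den, coef s * 0 by simp]
        refine tendsto_finsetSum _ fun s _ => Tendsto.const_mul _ ?_
        refine ih _ ?_ ⟨j, hj, ?_⟩
        · refine (natDegree_add_le _ _).trans (max_le (natDegree_sub_C_mul_X_pow_le hp) ?_)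
          exact (natDegree_C_mul_le _ _).trans (by simp)
        · rw [coeff_add, coeff_sub, coeff_C_mul, coeff_C_mul, coeff_X_pow, if_neg (by omega),
            mul_zero, sub_zero, coeff_X]
          split_ifs with h1
          · rw [mul_one, show (s : ℝ) / ρ.den = ((s / ρ.den : ℚ) : ℝ) by push_cast; rfl]
            exact hirr.add_ratCast _
          · rw [mul_zero, add_zero]
            exact hirr

/-- `∫_{𝕋^ι} e(m · x) dx = [m = 0]`. [folklore] -/
theorem integral_mFourier_eq {ι : Type*} [Fintype ι] (m : ι → ℤ) :
    ∫ x : UnitAddTorus ι, mFourier m x = if m = 0 then 1 else 0 := by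
  classical
  have h1 : ∀ n : ℤ, ∫ y : UnitAddCircle, fourier n y = if n = 0 then 1 else 0 := by
    intro n
    have hvol : (volume : Measure UnitAddCircle) = AddCircle.haarAddCircle := by
      rw [AddCircle.volume_eq_smul_haarAddCircle, ENNReal.ofReal_one, one_smul]
    have h := congrFun (fourierCoeff_fourier (T := 1) n) 0
    rw [fourierCoeff, Pi.single_apply] at h
    simp only [neg_zero, fourier_zero, one_smul] at h
    rw [hvol, h]
    simp only [eq_comm]
  have h2 : ∫ x : UnitAddTorus ι, mFourier m x = ∏ i, ∫ y : UnitAddCircle, fourier (m i) y := by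
    simp only [mFourier, ContinuousMap.coe_mk]
    exact MeasureTheory.integral_fintype_prod_volume_eq_prod (fun i => (fourier (m i) : UnitAddCircle → ℂ))
  rw [h2]
  simp_rw [h1]
  by_cases hm : m = 0
  · subst hm; simp
  · obtain ⟨i, hi⟩ := Function.ne_iff.1 hm
    rw [if_neg hm]
    exact Finset.prod_eq_zero (Finset.mem_univ i) (if_neg hi)

/-- **Weyl 1916, Satz 14, along Følner sequences (equidistribution of polynomial orbits in the
torus).** If for every `m ∈ ℤ^ι ∖ {0}` the polynomial `Σᵢ mᵢ Pᵢ` has an irrational coefficient of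
positive degree, then for every continuous `G : 𝕋^ι → ℂ` and every Følner sequence `Φ` of `ℤ`,
`|Φ_N|⁻¹ Σ_{n ∈ Φ_N} G((Pᵢ(n) mod 1)ᵢ) → ∫_{𝕋^ι} G` (Haar probability measure).
[cite: Weyl1916, Satz 14] -/
theorem weyl_tendsto_avg_integral_torus {ι : Type*} [Fintype ι] (P : ι → ℝ[X])
    (hP : ∀ m : ι → ℤ, m ≠ 0 →
      ∃ j, 1 ≤ j ∧ Irrational ((∑ i, C ((m i : ℝ)) * P i).coeff j))
    (G : C(UnitAddTorus ι, ℂ)) {Φ : ℕ → Finset ℤ} (hΦ : IsFoelnerSeq Φ) :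
    Tendsto (fun N => ((Φ N).card : ℂ)⁻¹ *
      ∑ n ∈ Φ N, G (fun i => ((((P i).eval (n : ℝ) : ℝ)) : UnitAddCircle))) atTop
      (𝓝 (∫ x, G x)) := by
  classical
  haveI : IsProbabilityMeasure (volume : Measure UnitAddCircle) := ⟨UnitAddCircle.measure_univ⟩
  haveI : IsProbabilityMeasure (volume : Measure (UnitAddTorus ι)) := by
    rw [MeasureTheory.volume_pi]
    infer_instance
  have hint : ∀ F : C(UnitAddTorus ι, ℂ), Integrable F :=
    fun F => F.continuous.integrable_of_hasCompactSupport (HasCompactSupport.of_compactSpace F)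
  have hbound : ∀ F : C(UnitAddTorus ι, ℂ), ‖∫ x, F x‖ ≤ ‖F‖ := by
    intro F
    refine (norm_integral_le_of_norm_le_const (C := ‖F‖)
      (Eventually.of_forall fun x => F.norm_coe_le_norm x)).trans ?_
    simp [probReal_univ]
  -- the subspace of test functions whose averages converge to the integral
  let S : Submodule ℂ C(UnitAddTorus ι, ℂ) :=
    { carrier := {G | ∀ Φ : ℕ → Finset ℤ, IsFoelnerSeq Φ →
        Tendsto (fun N => ((Φ N).card : ℂ)⁻¹ *
          ∑ n ∈ Φ N, G (fun i => ((((P i).eval (n : ℝ) : ℝ)) : UnitAddCircle))) atTop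
          (𝓝 (∫ x, G x))}
      add_mem' := by
        intro G₁ G₂ h₁ h₂ Φ hΦ
        have := (h₁ Φ hΦ).add (h₂ Φ hΦ)
        rw [show (∫ x, (G₁ + G₂) x) = (∫ x, G₁ x) + ∫ x, G₂ x from by
          simp only [ContinuousMap.add_apply]; exact integral_add (hint G₁) (hint G₂)]
        refine this.congr' (Eventually.of_forall fun N => ?_)
        simp only [ContinuousMap.add_apply, Finset.sum_add_distrib, mul_add]
      zero_mem' := fun Φ hΦ => by simp
      smul_mem' := by
        intro a G h Φ hΦ
        have := (h Φ hΦ).const_mul a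
        rw [show (∫ x, (a • G) x) = a * ∫ x, G x from by
          simp only [ContinuousMap.smul_apply, smul_eq_mul]; exact integral_const_mul a _]
        refine this.congr' (Eventually.of_forall fun N => ?_)
        simp only [ContinuousMap.smul_apply, smul_eq_mul, Finset.mul_sum]
        exact Finset.sum_congr rfl fun n _ => by ring }
  -- characters
  have hchar : ∀ m : ι → ℤ, mFourier m ∈ S := by
    intro m Φ hΦ
    rw [integral_mFourier_eq]
    by_cases hm : m = 0
    · subst hm
      simp only [mFourier_zero, ContinuousMap.one_apply, if_true]
      exact hΦ.tendsto_avg_const 1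
    · rw [if_neg hm]
      simp_rw [mFourier_apply_polyOrbit]
      exact hΦ.tendsto_avg_e_poly_zero _ _ le_rfl (hP m hm)
  -- closedness
  have hclosed : IsClosed (S : Set C(UnitAddTorus ι, ℂ)) := by
    refine IsSeqClosed.isClosed fun Gk G hGk hG => ?_
    intro Φ hΦ
    rw [Metric.tendsto_atTop]
    intro ε hε
    have hε3 : 0 < ε / 3 := by positivity
    obtain ⟨k, hk⟩ := (Metric.tendsto_nhds.1 hG _ hε3).exists
    obtain ⟨N₀, hN₀⟩ := Metric.tendsto_atTop.1 (hGk k Φ hΦ) _ hε3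
    refine ⟨N₀, fun N hN => ?_⟩
    have hA : ‖((Φ N).card : ℂ)⁻¹ *
          ∑ n ∈ Φ N, G (fun i => ((((P i).eval (n : ℝ) : ℝ)) : UnitAddCircle)) -
        ((Φ N).card : ℂ)⁻¹ *
          ∑ n ∈ Φ N, Gk k (fun i => ((((P i).eval (n : ℝ) : ℝ)) : UnitAddCircle))‖ ≤ ε / 3 := by
      rw [← mul_sub, ← Finset.sum_sub_distrib]
      refine FoelnerWeyl.norm_avg_le hε3.le fun n => ?_
      have := (G - Gk k).norm_coe_le_norm (fun i => ((((P i).eval (n : ℝ) : ℝ)) : UnitAddCircle))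
      simp only [ContinuousMap.sub_apply] at this
      refine this.trans ?_
      rw [← dist_eq_norm, dist_comm]
      exact hk.le
    have hB : ‖(∫ x, Gk k x) - ∫ x, G x‖ ≤ ε / 3 := by
      rw [← integral_sub (hint _) (hint _)]
      have := hbound (Gk k - G)
      simp only [ContinuousMap.sub_apply] at this
      refine this.trans ?_
      rw [← dist_eq_norm]
      exact hk.le
    calc dist (((Φ N).card : ℂ)⁻¹ *
            ∑ n ∈ Φ N, G (fun i => ((((P i).eval (n : ℝ) : ℝ)) : UnitAddCircle))) (∫ x, G x)
        ≤ ‖((Φ N).card : ℂ)⁻¹ *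
              ∑ n ∈ Φ N, G (fun i => ((((P i).eval (n : ℝ) : ℝ)) : UnitAddCircle)) -
            ((Φ N).card : ℂ)⁻¹ *
              ∑ n ∈ Φ N, Gk k (fun i => ((((P i).eval (n : ℝ) : ℝ)) : UnitAddCircle))‖ +
          dist (((Φ N).card : ℂ)⁻¹ *
              ∑ n ∈ Φ N, Gk k (fun i => ((((P i).eval (n : ℝ) : ℝ)) : UnitAddCircle)))
            (∫ x, Gk k x) +
          ‖(∫ x, Gk k x) - ∫ x, G x‖ := by
            rw [← dist_eq_norm, ← dist_eq_norm]
            exact dist_triangle4 _ _ _ _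
      _ < ε / 3 + ε / 3 + ε / 3 := by linarith [hA, hN₀ N hN, hB]
      _ = ε := by ring
  have htop : (⊤ : Submodule ℂ C(UnitAddTorus ι, ℂ)) ≤ S := by
    rw [← span_mFourier_closure_eq_top]
    exact Submodule.topologicalClosure_minimal _ (Submodule.span_le.2 (by
      rintro _ ⟨m, rfl⟩
      exact hchar m)) hclosed
  exact htop (Submodule.mem_top : G ∈ ⊤) Φ hΦ

/-- **Weyl's theorem for one polynomial, Følner form, with the value of the limit**: if `p` has an
irrational coefficient of positive degree then for every continuous `G : ℝ/ℤ → ℂ`,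
`|Φ_N|⁻¹ Σ_{n ∈ Φ_N} G(p(n) mod 1) → ∫_{ℝ/ℤ} G` along every Følner sequence (Satz 12: the
values `p(n)` are equidistributed mod 1). [cite: Weyl1916, Satz 12] -/
theorem weyl_tendsto_avg_integral_circle (p : ℝ[X]) (hp : ∃ j, 1 ≤ j ∧ Irrational (p.coeff j))
    (G : C(UnitAddCircle, ℂ)) {Φ : ℕ → Finset ℤ} (hΦ : IsFoelnerSeq Φ) :
    Tendsto (fun N => ((Φ N).card : ℂ)⁻¹ *
      ∑ n ∈ Φ N, G (((p.eval (n : ℝ) : ℝ)) : UnitAddCircle)) atTop (𝓝 (∫ x, G x)) := by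
  -- transport along the homeomorphism `𝕋^{Unit} ≃ 𝕋`
  let G' : C(UnitAddTorus Unit, ℂ) := G.comp ⟨fun x => x (), continuous_apply ()⟩
  have hP : ∀ m : Unit → ℤ, m ≠ 0 →
      ∃ j, 1 ≤ j ∧ Irrational ((∑ i, C ((m i : ℝ)) * (fun _ : Unit => p) i).coeff j) := by
    intro m hm
    obtain ⟨j, hj, hirr⟩ := hp
    refine ⟨j, hj, ?_⟩
    have hm0 : m () ≠ 0 := fun h => hm (funext fun u => by cases u; exact h)
    simp only [Finset.univ_unique, Finset.sum_singleton, coeff_C_mul]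
    rw [show (((m default : ℤ) : ℝ)) * p.coeff j = (((m default : ℤ) : ℝ)) * p.coeff j from rfl]
    exact_mod_cast hirr.intCast_mul hm0
  have h := weyl_tendsto_avg_integral_torus (fun _ : Unit => p) hP G' hΦ
  have hG' : ∀ x : UnitAddCircle, G' (fun _ => x) = G x := fun x => rfl
  simp only [G', ContinuousMap.comp_apply, ContinuousMap.coe_mk] at h
  convert h using 2
  -- `∫ G = ∫ G'` by the measure-preserving map `x ↦ (fun _ => x)`
  have hmp : MeasurePreserving (fun x : Unit → UnitAddCircle => x ())
      (volume : Measure (Unit → UnitAddCircle)) volume :=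
    (MeasureTheory.volume_preserving_funUnique Unit UnitAddCircle)
  rw [← hmp.integral_comp (MeasurableEquiv.funUnique Unit UnitAddCircle).measurableEmbedding]

end WeylValue


/-! ### Weyl's Satz 12 in counting form: polynomial sequences are uniformly distributed mod 1

The tree's two (identical) renderings of "uniformly distributed mod 1" for `ℕ`-indexed sequences,
`IsUniformlyDistributedModOne` (`FloorMultipleSequenceUD.lean`) and `IsUDModOne`
(`GeneralizedPolynomialsUD.lean`), are established for `n ↦ p(n)` whenever `p` has an irrational
coefficient of positive degree — Weyl 1916, Satz 12 — by feeding the Følner-form Weyl sums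
(`IsFoelnerSeq.tendsto_avg_e_poly_zero`) into the tree's arc-counting half of Weyl's criterion
`WeylCircle.tendsto_card_arc_div` (`WeylCriterionArcs.lean`); the same for the notion
`UniformDistribution.EquidistributedModOne` (`UniformDistribution/EquidistributedModOne.lean`,
Kuipers–Niederreiter Def. 1.1, indices `n < N`), whose file proves the leading-coefficient case
(`UniformDistribution.equidistributedModOne_polynomial`, via van der Corput on `ℕ`); here the
hypothesis is Weyl's: SOME coefficient of positive degree irrational. -/

section Counting

/-- The arc condition of `WeylCircle.tendsto_card_arc_div` at `β = 2πa`, `α = 2π(b - a)` is the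
condition `{x} ∈ [a, b)`; the tree's `FloorMultipleUD.toIcoMod_two_pi_lt_iff`, deprecated
restatement (dedup-01114, 2026-08-16). [folklore] -/
@[deprecated FloorMultipleUD.toIcoMod_two_pi_lt_iff (since := "2026-08-16")]
theorem FoelnerWeyl.toIcoMod_two_pi_lt_iff {a b : ℝ} (ha : 0 ≤ a) (hab : a < b) (hb : b ≤ 1)
    (x : ℝ) :
    toIcoMod Real.two_pi_pos (2 * Real.pi * a) (2 * Real.pi * x) <
        2 * Real.pi * a + 2 * Real.pi * (b - a) ↔
      Int.fract x ∈ Set.Ico a b :=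
  FloorMultipleUD.toIcoMod_two_pi_lt_iff ha hab hb x

/-- Vanishing Følner averages are `o(|Φ_N|)` sums. [folklore] -/
theorem IsFoelnerSeq.isLittleO_sum_of_tendsto_avg {Φ : ℕ → Finset ℤ} (hΦ : IsFoelnerSeq Φ)
    {f : ℤ → ℂ} (h : Tendsto (fun N => ((Φ N).card : ℂ)⁻¹ * ∑ n ∈ Φ N, f n) atTop (𝓝 0)) :
    (fun N => ∑ n ∈ Φ N, f n) =o[atTop] fun N => ((Φ N).card : ℝ) := by
  rw [Asymptotics.isLittleO_iff]
  intro c hc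
  have h1 := (NormedAddGroup.tendsto_nhds_zero.1 h) c hc
  filter_upwards [h1, hΦ.eventually_card_pos] with N hN hpos
  rw [FoelnerWeyl.norm_avg_eq, div_lt_iff₀ hpos] at hN
  rw [Real.norm_natCast]
  exact hN.le

/-- **Weyl 1916, Satz 12, counting form along Følner sequences.** If the real polynomial `p` has an
irrational coefficient of positive degree, then for `0 ≤ a < b ≤ 1` the proportion of `n ∈ Φ_N`
with `{p(n)} ∈ [a, b)` tends to `b - a`, for every Følner sequence `Φ` of `ℤ`.
[cite: Weyl1916, Satz 12] -/
theorem weyl_tendsto_card_fract_mem_Ico (p : ℝ[X]) (hp : ∃ j, 1 ≤ j ∧ Irrational (p.coeff j))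
    {Φ : ℕ → Finset ℤ} (hΦ : IsFoelnerSeq Φ) {a b : ℝ} (ha : 0 ≤ a) (hab : a < b) (hb : b ≤ 1) :
    Tendsto (fun N => (((Φ N).filter fun n : ℤ =>
        Int.fract (p.eval (n : ℝ)) ∈ Set.Ico a b).card : ℝ) / (Φ N).card) atTop (𝓝 (b - a)) := by
  classical
  have h0 : Tendsto (fun N => (Φ N).card) atTop atTop :=
    tendsto_natCast_atTop_iff.1 hΦ.tendsto_card_atTop
  have hW : ∀ k : ℤ, k ≠ 0 →
      (fun N => ∑ x ∈ Φ N, Complex.exp (k * ((2 * Real.pi * p.eval (x : ℝ) : ℝ) : ℂ) * Complex.I))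
        =o[atTop] fun N => ((Φ N).card : ℝ) := by
    intro k hk
    obtain ⟨j, hj, hirr⟩ := hp
    have hq : ∃ j, 1 ≤ j ∧ Irrational ((C ((k : ℤ) : ℝ) * p).coeff j) := by
      refine ⟨j, hj, ?_⟩
      rw [coeff_C_mul]
      exact hirr.intCast_mul hk
    have h := hΦ.isLittleO_sum_of_tendsto_avg (hΦ.tendsto_avg_e_poly_zero _ _ le_rfl hq)
    refine h.congr' (Eventually.of_forall fun N => Finset.sum_congr rfl fun n _ => ?_) EventuallyEq.rfl
    congr 1
    simp only [eval_mul, eval_C]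
    push_cast
    ring
  have h := WeylCircle.tendsto_card_arc_div Φ (fun n : ℤ => 2 * Real.pi * p.eval (n : ℝ)) h0 hW
    (2 * Real.pi * a) (α := 2 * Real.pi * (b - a)) (by nlinarith [Real.pi_pos])
    (by nlinarith [Real.pi_pos])
  rw [show 2 * Real.pi * (b - a) / (2 * Real.pi) = b - a by field_simp [Real.pi_ne_zero]] at h
  refine h.congr fun N => ?_
  congr 3
  exact Finset.filter_congr fun n _ => FloorMultipleUD.toIcoMod_two_pi_lt_iff ha hab hb _

/-- `{1, …, N} ⊂ ℤ` is a Følner sequence. [cite: BergelsonLeibman2007, §0.21] -/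
theorem isFoelnerSeq_Icc : IsFoelnerSeq fun N => Finset.Icc (1 : ℤ) N := by
  refine ⟨?_, ?_⟩
  · filter_upwards [eventually_ge_atTop 1] with N hN
    exact ⟨1, Finset.mem_Icc.2 ⟨le_rfl, by exact_mod_cast hN⟩⟩
  · have hcard : ∀ N : ℕ, ((Finset.Icc (1 : ℤ) N) ∆
        ((Finset.Icc (1 : ℤ) N).image fun n => n + 1)).card ≤ 2 := by
      intro N
      have hsub : (Finset.Icc (1 : ℤ) N) ∆ ((Finset.Icc (1 : ℤ) N).image fun n => n + 1) ⊆
          {(1 : ℤ), (N : ℤ) + 1} := by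
        intro x hx
        simp only [Finset.mem_symmDiff, Finset.mem_Icc, Finset.mem_image, Finset.mem_insert,
          Finset.mem_singleton] at hx ⊢
        rcases hx with ⟨⟨h0, hN⟩, hnot⟩ | ⟨⟨a, ⟨ha0, haN⟩, rfl⟩, hnot⟩
        · push Not at hnot
          have := hnot (x - 1)
          omega
        · omega
      exact (Finset.card_le_card hsub).trans (Finset.card_le_two)
    have hN : ∀ N : ℕ, ((Finset.Icc (1 : ℤ) N).card : ℝ) = N := by
      intro N
      rw [Int.card_Icc]
      simp
    refine squeeze_zero (fun N => by positivity) (fun N => ?_)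
      (tendsto_const_div_atTop_nhds_zero_nat (2 : ℝ))
    rw [hN]
    rcases Nat.eq_zero_or_pos N with h | h
    · subst h; simp
    · gcongr
      exact_mod_cast hcard N

/-- `{1, …, N} ⊂ ℕ` cast into `ℤ` is `{1, …, N} ⊂ ℤ`. [folklore] -/
theorem FoelnerWeyl.map_natCast_Icc (N : ℕ) :
    (Finset.Icc 1 N).map Nat.castEmbedding = Finset.Icc (1 : ℤ) N := by
  ext x
  simp only [Finset.mem_map, Finset.mem_Icc, Nat.castEmbedding_apply]
  constructor
  · rintro ⟨n, ⟨h1, h2⟩, rfl⟩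
    exact ⟨by exact_mod_cast h1, by exact_mod_cast h2⟩
  · rintro ⟨h1, h2⟩
    refine ⟨x.toNat, ⟨?_, ?_⟩, ?_⟩
    · omega
    · omega
    · exact Int.toNat_of_nonneg (by omega)

/-- **Weyl 1916, Satz 12, in the tree's vocabulary** (`IsUniformlyDistributedModOne`,
Kuipers–Niederreiter Ch. 1 Def. 1.1 / Håland 1994 Def. 2.1): if the real polynomial `p` has an
irrational coefficient of positive degree then `(p(n))_{n ≥ 1}` is uniformly distributed mod 1.
[cite: Weyl1916, Satz 12] -/
theorem isUniformlyDistributedModOne_polynomial (p : ℝ[X])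
    (hp : ∃ j, 1 ≤ j ∧ Irrational (p.coeff j)) :
    IsUniformlyDistributedModOne fun n : ℕ => p.eval (n : ℝ) := by
  classical
  intro a b ha hab hb
  have h := weyl_tendsto_card_fract_mem_Ico p hp isFoelnerSeq_Icc ha hab hb
  refine h.congr fun N => ?_
  rw [← FoelnerWeyl.map_natCast_Icc, Finset.filter_map, Finset.card_map, Finset.card_map,
    Nat.card_Icc, Nat.add_sub_cancel]
  congr 2

/-- The same statement for the tree's second rendering `IsUDModOne` (Håland 1994, Def. 2.1, as
used in `GeneralizedPolynomialsUD.lean`). [cite: Weyl1916, Satz 12] -/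
theorem isUDModOne_polynomial (p : ℝ[X]) (hp : ∃ j, 1 ≤ j ∧ Irrational (p.coeff j)) :
    IsUDModOne fun n : ℕ => p.eval (n : ℝ) :=
  isUniformlyDistributedModOne_polynomial p hp

/-- In particular (Weyl 1916, Satz 13 / the degree-one case of Satz 12): `(nθ)` is uniformly
distributed mod 1 for irrational `θ`. [cite: Weyl1916, Satz 13] -/
theorem isUniformlyDistributedModOne_mul_irrational {θ : ℝ} (hθ : Irrational θ) :
    IsUniformlyDistributedModOne fun n : ℕ => (n : ℝ) * θ := by
  have h := isUniformlyDistributedModOne_polynomial (C θ * X) ⟨1, le_rfl, by simpa using hθ⟩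
  have hfun : (fun n : ℕ => (C θ * X).eval (n : ℝ)) = fun n : ℕ => (n : ℝ) * θ := by
    funext n
    rw [eval_mul, eval_C, eval_X, mul_comm]
  rw [hfun] at h
  exact h

/-- `{0, …, N-1} ⊂ ℕ` cast into `ℤ` is `[0, N) ⊂ ℤ`. [folklore] -/
theorem FoelnerWeyl.map_natCast_range (N : ℕ) :
    (Finset.range N).map Nat.castEmbedding = Finset.Ico (0 : ℤ) N := by
  ext x
  simp only [Finset.mem_map, Finset.mem_range, Finset.mem_Ico, Nat.castEmbedding_apply]
  constructor
  · rintro ⟨n, hn, rfl⟩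
    exact ⟨by positivity, by exact_mod_cast hn⟩
  · rintro ⟨h1, h2⟩
    exact ⟨x.toNat, by omega, Int.toNat_of_nonneg h1⟩

/-- **Weyl 1916, Satz 12, for the route's notion `EquidistributedModOne`** (Kuipers–Niederreiter
Ch. 1 Def. 1.1, indices `n < N`): if SOME coefficient of positive degree of `p ∈ ℝ[X]` is irrational
then `(p(n))_{n ≥ 0}` is uniformly distributed mod 1 (the file `EquidistributedModOne.lean` has the
leading-coefficient case; the general case reduces to it by the finite Fourier expansion of the
rational top part, `IsFoelnerSeq.tendsto_avg_e_poly_zero`). [cite: Weyl1916, Satz 12] -/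
theorem equidistributedModOne_polynomial_of_irrational_coeff (p : ℝ[X])
    (hp : ∃ j, 1 ≤ j ∧ Irrational (p.coeff j)) :
    UniformDistribution.EquidistributedModOne fun n : ℕ => p.eval (n : ℝ) := by
  refine UniformDistribution.equidistributedModOne_of_isLittleO_weylSum fun h hh => ?_
  obtain ⟨j, hj, hirr⟩ := hp
  have hq : ∃ j, 1 ≤ j ∧ Irrational ((C ((h : ℤ) : ℝ) * p).coeff j) :=
    ⟨j, hj, by rw [coeff_C_mul]; exact hirr.intCast_mul hh⟩
  have hW := isFoelnerSeq_Ico.isLittleO_sum_of_tendsto_avg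
    (isFoelnerSeq_Ico.tendsto_avg_e_poly_zero _ _ le_rfl hq)
  refine (hW.congr' (Eventually.of_forall fun N => ?_) (Eventually.of_forall fun N => ?_))
  · beta_reduce
    rw [← FoelnerWeyl.map_natCast_range, Finset.sum_map]
    refine Finset.sum_congr rfl fun n _ => ?_
    simp only [Nat.castEmbedding_apply, Int.cast_natCast, eval_mul, eval_C]
  · beta_reduce
    rw [Int.card_Ico]
    simp

end Counting

end Literature.NumberTheory.DiophantineApproximation

end
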